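import Mathlib
import Literature.NumberTheory.ConnesConsani.ScalingSiteH0Param
import HarnessLib

/-!
# The structure of the `ℝ_max`-module `ℰ_{N,p}` (Connes–Consani 2017, Appendix A): extremal rays

A. Connes, C. Consani, *Geometry of the scaling site*, Selecta Math. 23 (2017), Appendix A
(= §6 "The structure of the `ℝ_max`-module `ℰ_{N,p}`" of arXiv:1603.03191), with Lemma 5.19 (ii).
In the Riemann–Roch theorem of type II on the periodic orbit `C_p` (Thm. 5.17, PROVED in the tree:
`ConnesConsani2017_thm_5_17_holds`, files `ScalingSitePeriodicOrbit/H0Levels/H0Param/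
RiemannRochProofs.lean`) the finite levels `H⁰(D)^{pⁿ}` of the filtration of `H⁰(D)` by the
`p`-adic size of slopes are, after a Frobenius twist (Lemma 5.18 (ii)), modules of the type
`ℰ_{N,p} := H⁰(D)¹`, `D = (H_p, N)`: by Lemma 5.19 (i) "the `ℝ_max`-module of convex (continuous),
piecewise affine functions on `[1,p]` with integral slopes, such that `f(1) = f(p)` and
`-f'₊(1) + p f'₋(p) ≤ N`". Appendix A describes the STRUCTURE of this module — the one finite-level
object of the scaling site in print: it is generated, as a max-plus module, by the `N - p + 1`
extremal rays of the explicit functions `φ_a(x) = max{-a(x-1), b(x-p)}`, `b = E((N-a)/p)`,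
`0 ≤ a ≤ N - p` (Lemma 5.19 (ii)), with the explicit section `γ_a(f) = -max_{[1,p]}(φ_a - f)`.
This file formalizes that appendix, together with Lemma 5.19 (i)–(ii) linking it to the tree's
`H⁰(D)^ρ = CpH0Level D ρ`; everything is PROVED, no named facts are introduced.

## Main statements

* `ENp.IsENp p N g` — `g ∈ ℰ_{N,p}` (Lemma 5.19 (i) / App. A first sentence), for a real function
  read on `[1,p]`; `ENp.phi p N a` — `φ_a`; `ENp.gam p N f a` — `γ_a(f)`; `ENp.sigma p N hN x` —
  `σ(x) = ∨_a (φ_a + x_a)`; `ENp.IsExtremal` — Definition 6.1.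
* `ENp.phi_isENp` — Lemma 5.19 (ii)/Prop. 6.2: `φ_a ∈ ℰ_{N,p}` for `0 ≤ a ≤ N - p`
  (`f'₊(1) = -a`, `f'₋(p) = b`, `a + pb ≤ N`).
* `ENp.ConnesConsani2017_lemma_6_3_i` — Lemma 6.3 (i): for `f ∈ ℰ_{N,p}`, `x ∈ (1,p)` there is
  `a ∈ {0,…,N-p}` with `f(z) - f(x) ≥ φ_a(z) - φ_a(x)` on `[1,p]` (also at the end points,
  `ENp.lemma_6_3_i_Icc`).
* `ENp.ConnesConsani2017_lemma_6_3_ii` — Lemma 6.3 (ii): `f = ∨_a (φ_a + γ_a(f))` on `[1,p]`.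
* `ENp.ConnesConsani2017_prop_6_2_surjective` — Prop. 6.2: `σ` is onto `ℰ_{N,p}` (the `φ_a`
  generate the module); `ENp.sigma_isENp` — `σ(x) ∈ ℰ_{N,p}`.
* `ENp.ConnesConsani2017_prop_6_2_extremal` — Prop. 6.2: each `φ_a + c` is extremal;
  `ENp.ConnesConsani2017_prop_6_2_extremal_iff` — the extremal elements of `ℰ_{N,p}` are exactly
  the `φ_a + c` ("the `φ_a` generate all the extremal rays").
* `ENp.isENp_of_pieceData` — the literal printed description (break points, integral non-decreasing
  slopes, `f(1) = f(p)`, `-s₀ + p s_n ≤ N`) implies membership in `IsENp` (faithfulness of the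
  rendering, see below); `ENp.PieceData.line_le` — each piece's affine extension minorises `f`.
* `ENp.ConnesConsani2017_lemma_5_19_i` — Lemma 5.19 (i): `IsENp p N F ↔ F` is, on `[1,p]`, the
  restriction of an element of the tree's `H⁰((H_p,N))¹ = CpH0Level (divHpN p hp N) 1`
  (`ENp.isENp_of_cpH0Level`, direction ⇒, via `RepData` of `ScalingSiteH0Param.lean`;
  `ENp.exists_cpH0Level_of_isENp`, direction ⇐: the `p`-periodic extension of a member, with
  break points the crossing points of the representing family, integral slopes (`‖·‖_p ≤ 1`),
  `(f) ≥ 0` off `λ = 1` by convexity and `N + Ord(f)(1) ≥ 0` by the order condition).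
* API: `ENp.IsENp.sup`, `ENp.IsENp.add_const` (module operations), `ENp.IsENp.convexOn`,
  supporting lines `ENp.support_one/support_p/support_at`, one-sided slopes
  `ENp.derivWithin_one/derivWithin_p` (integers).

## Rendering of `ℰ_{N,p}` (read this first)

An element is a function `g : ℝ → ℝ` read on `[1,p]` (values off `[1,p]` never enter; equality
of elements is equality on `[1,p]`, the module operation is pointwise `max`, the `ℝ_max = ℝ ∪ {-∞}`
action is `g ↦ g + c`; the constant `-∞` and `-∞` coordinates of `σ` are not represented — Lemma 6.3
(ii) produces real coordinates `γ_a(f)`). "Convex, piecewise affine, continuous, with integral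
slopes on `[1,p]`" is rendered as: on `[1,p]`, `g` is the maximum of a nonempty FINITE family of
affine maps `t ↦ m t + c` with `m ∈ ℤ` (`ENp.ev`). These finite maxima are exactly the functions
named in the source (a finite maximum of integral-slope affine maps is convex, continuous and
piecewise affine with slopes among the `m`'s; conversely a convex continuous piecewise-affine
function on a compact interval is the maximum of the affine extensions of its finitely many pieces,
by convexity — `ENp.isENp_of_pieceData` proves this direction: piece data ⇒ member), and the
rendering makes the module operations and the supporting-line inequality
(`f(u) ≥ f(v) + f'(v)(u - v)`, the first display of App. A, "for `f'(v)` any value between the left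
and right limits") one-line facts. The one-sided derivatives `f'₊(1)`, `f'₋(p)` are Mathlib's
`derivWithin g (Ioi 1) 1`, `derivWithin g (Iio p) p` (the convention of `cpOrder` in
`ScalingSitePeriodicOrbit.lean`); they are computed (`ENp.derivWithin_one/_p`) as the largest,
resp. smallest, slope active at the end point. The index set `{0, …, N-p}` is `ENp.idx`
(`a ∈ idx ↔ a + p ≤ N`), under the standing hypothesis `p ≤ N` of Prop. 6.2 (for `N < p` the set
`{0,…,N-p}` of the source is empty while `ℰ_{N,p}` = constants, so the hypothesis is necessary);
`b = E((N-a)/p)` is `(N - a) / p` in `ℕ` with `a ≤ N` throughout. Only `1 < p` is used (the source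
has `p` prime).

## Proofs

Lemma 6.3 (i) follows the printed case distinction "`f'(x) ≤ 0`" (`a = -f'(x)`, `φ_a(x) = -a(x-1)`,
`β ≤ b` because `β = f'₋(p)` is an integer with `a + pβ ≤ N`) / "`f'(x) > 0`" (`a = N - p f'(x)`,
`b = f'(x)`, `φ_a(x) = b(x-p)`), written once for an abstract function with the three supporting
lines the proof invokes (`ENp.lemma_6_3_i_caseA/B`); at a kink `f'(x)` is the slope of an affine
map active at `x` (so the source's reduction "one can assume that `f` is affine at `x`" is not
needed). Lemma 6.3 (ii) and the surjectivity of `σ` are then immediate (`γ_a(f)` is the infimum of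
`f - φ_a`, attained where `φ_a` is tight). Extremality of `φ_a`: as printed, one of `f₁, f₂` agrees
with `φ_a` near `λ = 1` (value and right slope, read off two points of a right neighbourhood of `1`
where all three functions are affine — `ENp.germ_eq_of_max_eq`), and then `f_j ≥ φ_a` from the
supporting lines of `f_j` at `1` and at `p` together with `β_j ≤ b` (`ENp.eq_phi_of_le_of_germ`).
"Any extremal element is of the form `φ_a + t`": from (ii), peeling off one generator at a time
(finite maxima of rays are members, `ENp.sigma_isENp`).

## What is NOT here

* Lemma 5.19 (iii)–(iv) (`dim_top ℰ_{N,p} = N - p + 1`) live in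
  `ScalingSiteH0Param/RiemannRochProofs.lean` and are not repeated.
* The description of the fibres `σ⁻¹(f)` and of `γ` as the largest section (last paragraph of
  App. A) is not formalized.

## References

* [ConnesConsani2017ScalingSite] A. Connes, C. Consani, *Geometry of the scaling site*, Selecta
  Math. (N.S.) 23 (2017) 1803–1850, doi:10.1007/s00029-017-0313-y = arXiv:1603.03191: §5.4
  Lemma 5.19 (i)–(ii); Appendix A (arXiv §6): Definition 6.1, Proposition 6.2, Lemma 6.3 and its
  proof (read at page: held text `paper:arxiv-1603.03191`, chunks p0020–p0023).

## Mathlib / tree search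

No max-plus module of piecewise-affine functions and no "extremal ray" notion for
`ℝ_max`-semimodules in Mathlib or the tree (`lean search 'extremal ray|MaxPlus|IsExtremal'`,
2026-08-20: Mathlib's `Tropical` is an order-dual semiring wrapper; the tree's `MaxPlusHom`
(`ArithmeticSite.lean`) is the semiring morphism `H_max → ℝ_max` of CC 2016; the homonyms
`Kerr.IsExtremal`, `DiffuseGroups….IsExtremal` are unrelated); tree: `Literature.NumberTheory.
ConnesConsani` has `CpH0Level`, `cpSlopeNorm`, Thm. 5.17 as above and nothing on Appendix A
(grep `extremal`, `6.2`, `6.3` in the ConnesConsani files: no hits). Used: `Finset.sup'` API,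
`Filter.eventually_all_finset`, `ContinuousAt.eventually_lt`, `HasDerivWithinAt.congr_of_eventuallyEq`,
`uniqueDiffWithinAt_Ioi/Iio`, `csInf_le`/`le_csInf`, `Finset.Nonempty.cons_induction`.
-/

noncomputable section

open Set Filter Topology

namespace Literature.NumberTheory.ConnesConsani

namespace ENp

/-! ## Finite maxima of affine maps with integral slopes -/

/-- The affine map `t ↦ m t + c` attached to a pair `q = (m, c) ∈ ℤ × ℝ` (an integral slope and a
real constant). [folklore] -/
def lineOf (q : ℤ × ℝ) (t : ℝ) : ℝ := (q.1 : ℝ) * t + q.2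

/-- `ev s hs t = max_{(m,c) ∈ s} (m t + c)`: the pointwise maximum of a nonempty finite family of
affine maps with integral slopes — a convex, continuous, piecewise affine function with integral
slopes. [folklore] -/
def ev (s : Finset (ℤ × ℝ)) (hs : s.Nonempty) (t : ℝ) : ℝ := s.sup' hs (fun q => lineOf q t)

/-- The affine map of a pair is the value at `x` plus slope times displacement. [folklore] -/
private theorem lineOf_eq (q : ℤ × ℝ) (x z : ℝ) : lineOf q z = lineOf q x + (q.1 : ℝ) * (z - x) := by
  unfold lineOf; ring

/-- Each member of the family lies below the maximum. [folklore] -/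
private theorem lineOf_le_ev {s : Finset (ℤ × ℝ)} (hs : s.Nonempty) {q : ℤ × ℝ} (hq : q ∈ s) (t : ℝ) :
    lineOf q t ≤ ev s hs t :=
  Finset.le_sup' (fun q => lineOf q t) hq

/-- The maximum is attained by some member ("active" at `t`). [folklore] -/
private theorem exists_active (s : Finset (ℤ × ℝ)) (hs : s.Nonempty) (t : ℝ) :
    ∃ q ∈ s, lineOf q t = ev s hs t := by
  obtain ⟨q, hq, h⟩ := Finset.exists_mem_eq_sup' hs (fun q => lineOf q t)
  exact ⟨q, hq, h.symm⟩

/-- The members active at `t` (those attaining the maximum at `t`). [folklore] -/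
def active (s : Finset (ℤ × ℝ)) (hs : s.Nonempty) (t : ℝ) : Finset (ℤ × ℝ) :=
  s.filter (fun q => lineOf q t = ev s hs t)

/-- Membership in the active set. [folklore] -/
private theorem mem_active {s : Finset (ℤ × ℝ)} {hs : s.Nonempty} {t : ℝ} {q : ℤ × ℝ} :
    q ∈ active s hs t ↔ q ∈ s ∧ lineOf q t = ev s hs t := by
  simp [active]

/-- The active set is nonempty. [folklore] -/
private theorem active_nonempty (s : Finset (ℤ × ℝ)) (hs : s.Nonempty) (t : ℝ) :
    (active s hs t).Nonempty := by
  obtain ⟨q, hq, h⟩ := exists_active s hs t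
  exact ⟨q, mem_active.2 ⟨hq, h⟩⟩

/-- The largest slope among the members active at `t` (the right slope of `ev` at `t`). [folklore] -/
def slopeMax (s : Finset (ℤ × ℝ)) (hs : s.Nonempty) (t : ℝ) : ℤ :=
  (active s hs t).sup' (active_nonempty s hs t) Prod.fst

/-- The smallest slope among the members active at `t` (the left slope of `ev` at `t`). [folklore] -/
def slopeMin (s : Finset (ℤ × ℝ)) (hs : s.Nonempty) (t : ℝ) : ℤ :=
  (active s hs t).inf' (active_nonempty s hs t) Prod.fst

/-- An active member with the largest slope. [folklore] -/
private theorem exists_active_slopeMax (s : Finset (ℤ × ℝ)) (hs : s.Nonempty) (t : ℝ) :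
    ∃ q ∈ s, lineOf q t = ev s hs t ∧ q.1 = slopeMax s hs t := by
  obtain ⟨q, hq, h⟩ := Finset.exists_mem_eq_sup' (active_nonempty s hs t) Prod.fst
  exact ⟨q, (mem_active.1 hq).1, (mem_active.1 hq).2, h.symm⟩

/-- An active member with the smallest slope. [folklore] -/
private theorem exists_active_slopeMin (s : Finset (ℤ × ℝ)) (hs : s.Nonempty) (t : ℝ) :
    ∃ q ∈ s, lineOf q t = ev s hs t ∧ q.1 = slopeMin s hs t := by
  obtain ⟨q, hq, h⟩ := Finset.exists_mem_eq_inf' (active_nonempty s hs t) Prod.fst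
  exact ⟨q, (mem_active.1 hq).1, (mem_active.1 hq).2, h.symm⟩

/-- The slope of an active member is at most `slopeMax`. [folklore] -/
private theorem slope_le_slopeMax {s : Finset (ℤ × ℝ)} {hs : s.Nonempty} {t : ℝ} {q : ℤ × ℝ} (hq : q ∈ s)
    (h : lineOf q t = ev s hs t) : q.1 ≤ slopeMax s hs t :=
  Finset.le_sup' Prod.fst (mem_active.2 ⟨hq, h⟩)

/-- The slope of an active member is at least `slopeMin`. [folklore] -/
private theorem slopeMin_le_slope {s : Finset (ℤ × ℝ)} {hs : s.Nonempty} {t : ℝ} {q : ℤ × ℝ} (hq : q ∈ s)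
    (h : lineOf q t = ev s hs t) : slopeMin s hs t ≤ q.1 :=
  Finset.inf'_le Prod.fst (mem_active.2 ⟨hq, h⟩)

/-- **Supporting line.** A member active at `x` minorises the maximum everywhere:
`ev x + m (z - x) ≤ ev z`. [cite: ConnesConsani2017ScalingSite, App. A (first display: f(u) ≥ f(v) + f'(v)(u-v))] -/
theorem support {s : Finset (ℤ × ℝ)} (hs : s.Nonempty) {q : ℤ × ℝ} (hq : q ∈ s) {x : ℝ}
    (hqx : lineOf q x = ev s hs x) (z : ℝ) : ev s hs x + (q.1 : ℝ) * (z - x) ≤ ev s hs z := by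
  have h1 := lineOf_eq q x z
  have h2 := lineOf_le_ev hs hq z
  linarith

/-- **Right affinity.** Just to the right of any point, the maximum is affine with slope
`slopeMax`. [cite: ConnesConsani2017ScalingSite, Lemma 5.19 (i) and Def. 5.14 (one-sided slopes h₊ of a piecewise affine function)] -/
theorem eventually_right (s : Finset (ℤ × ℝ)) (hs : s.Nonempty) (x : ℝ) :
    ∀ᶠ t in 𝓝[>] x, ev s hs t = ev s hs x + (slopeMax s hs x : ℝ) * (t - x) := by
  obtain ⟨q₀, hq₀, hq₀x, hq₀s⟩ := exists_active_slopeMax s hs x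
  have hup : ∀ q ∈ s, ∀ᶠ t in 𝓝[>] x,
      lineOf q t ≤ ev s hs x + (slopeMax s hs x : ℝ) * (t - x) := by
    intro q hq
    by_cases hact : lineOf q x = ev s hs x
    · have hle : (q.1 : ℝ) ≤ slopeMax s hs x := by exact_mod_cast slope_le_slopeMax hq hact
      filter_upwards [self_mem_nhdsWithin] with t ht
      have ht' : 0 ≤ t - x := by linarith [(show x < t from ht).le]
      have h1 := lineOf_eq q x t
      have h3 : (q.1 : ℝ) * (t - x) ≤ (slopeMax s hs x : ℝ) * (t - x) :=
        mul_le_mul_of_nonneg_right hle ht'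
      linarith
    · have hlt : lineOf q x < ev s hs x := lt_of_le_of_ne (lineOf_le_ev hs hq x) hact
      have hc1 : ContinuousAt (fun t => lineOf q t) x := by unfold lineOf; fun_prop
      have hc2 : ContinuousAt (fun t => ev s hs x + (slopeMax s hs x : ℝ) * (t - x)) x := by
        fun_prop
      have hev : ∀ᶠ t in 𝓝 x, lineOf q t < ev s hs x + (slopeMax s hs x : ℝ) * (t - x) :=
        hc1.eventually_lt hc2 (by simpa using hlt)
      exact (hev.filter_mono nhdsWithin_le_nhds).mono fun t ht => ht.le
  have hall := (Filter.eventually_all_finset s).2 hup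
  filter_upwards [hall] with t ht
  apply le_antisymm
  · exact Finset.sup'_le _ _ (fun q hq => ht q hq)
  · have := support hs hq₀ hq₀x t
    rw [hq₀s] at this
    exact this

/-- **Left affinity.** Just to the left of any point, the maximum is affine with slope
`slopeMin`. [cite: ConnesConsani2017ScalingSite, Lemma 5.19 (i) and Def. 5.14 (one-sided slopes h₋ of a piecewise affine function)] -/
theorem eventually_left (s : Finset (ℤ × ℝ)) (hs : s.Nonempty) (x : ℝ) :
    ∀ᶠ t in 𝓝[<] x, ev s hs t = ev s hs x + (slopeMin s hs x : ℝ) * (t - x) := by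
  obtain ⟨q₀, hq₀, hq₀x, hq₀s⟩ := exists_active_slopeMin s hs x
  have hup : ∀ q ∈ s, ∀ᶠ t in 𝓝[<] x,
      lineOf q t ≤ ev s hs x + (slopeMin s hs x : ℝ) * (t - x) := by
    intro q hq
    by_cases hact : lineOf q x = ev s hs x
    · have hle : (slopeMin s hs x : ℝ) ≤ q.1 := by exact_mod_cast slopeMin_le_slope hq hact
      filter_upwards [self_mem_nhdsWithin] with t ht
      have ht' : t - x ≤ 0 := by linarith [(show t < x from ht).le]
      have h1 := lineOf_eq q x t
      have h3 : (q.1 : ℝ) * (t - x) ≤ (slopeMin s hs x : ℝ) * (t - x) :=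
        mul_le_mul_of_nonpos_right hle ht'
      linarith
    · have hlt : lineOf q x < ev s hs x := lt_of_le_of_ne (lineOf_le_ev hs hq x) hact
      have hc1 : ContinuousAt (fun t => lineOf q t) x := by unfold lineOf; fun_prop
      have hc2 : ContinuousAt (fun t => ev s hs x + (slopeMin s hs x : ℝ) * (t - x)) x := by
        fun_prop
      have hev : ∀ᶠ t in 𝓝 x, lineOf q t < ev s hs x + (slopeMin s hs x : ℝ) * (t - x) :=
        hc1.eventually_lt hc2 (by simpa using hlt)
      exact (hev.filter_mono nhdsWithin_le_nhds).mono fun t ht => ht.le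
  have hall := (Filter.eventually_all_finset s).2 hup
  filter_upwards [hall] with t ht
  apply le_antisymm
  · exact Finset.sup'_le _ _ (fun q hq => ht q hq)
  · have := support hs hq₀ hq₀x t
    rw [hq₀s] at this
    exact this

/-! ## One-sided derivatives of eventually affine functions -/

/-- A function that is affine, `g t = g x + D (t - x)`, on a set of the filter `𝓝[S] x` has
derivative `D` at `x` within `S`. [folklore] -/
private theorem hasDerivWithinAt_of_eventually {g : ℝ → ℝ} {x D : ℝ} {S : Set ℝ}
    (h : ∀ᶠ t in 𝓝[S] x, g t = g x + D * (t - x)) : HasDerivWithinAt g D S x := by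
  have hlin : HasDerivAt (fun t => g x + D * (t - x)) D x := by
    simpa using (((hasDerivAt_id x).sub_const x).const_mul D).const_add (g x)
  exact hlin.hasDerivWithinAt.congr_of_eventuallyEq h (by simp)

/-- Right derivative of an eventually right-affine function. [folklore] -/
private theorem derivWithin_Ioi_eq {g : ℝ → ℝ} {x D : ℝ}
    (h : ∀ᶠ t in 𝓝[>] x, g t = g x + D * (t - x)) : derivWithin g (Ioi x) x = D :=
  (hasDerivWithinAt_of_eventually h).derivWithin (uniqueDiffWithinAt_Ioi x)

/-- Left derivative of an eventually left-affine function. [folklore] -/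
private theorem derivWithin_Iio_eq {g : ℝ → ℝ} {x D : ℝ}
    (h : ∀ᶠ t in 𝓝[<] x, g t = g x + D * (t - x)) : derivWithin g (Iio x) x = D :=
  (hasDerivWithinAt_of_eventually h).derivWithin (uniqueDiffWithinAt_Iio x)


/-! ## The module `ℰ_{N,p}` -/

/-- **The `ℝ_max`-module `ℰ_{N,p}`** (Lemma 5.19 (i); Appendix A, first sentence): "the
`ℝ_max`-module of convex, piecewise affine, continuous functions `f` on `[1,p]` with integral slopes
such that `f(1) = f(p)` and `-f'₊(1) + p f'₋(p) ≤ N`" (it is `H⁰(D)¹` for the divisor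
`D = (H_p, N)` of `C_p`, Lemma 5.19 (i)). Rendered for a real function `g` read on `[1,p]` (its
values off `[1,p]` are irrelevant): on `[1,p]`, `g` is the maximum of a nonempty finite family of
affine maps with integral slopes — these maxima are exactly the convex, continuous, piecewise
affine functions with integral slopes on the compact interval; `g 1 = g p`; and the one-sided
derivatives `f'₊(1)`, `f'₋(p)` (Mathlib's `derivWithin` on `Ioi 1`, `Iio p`, as in `cpOrder`)
satisfy `-f'₊(1) + p f'₋(p) ≤ N`. [cite: ConnesConsani2017ScalingSite, Lemma 5.19 (i); App. A (= §6 of arXiv:1603.03191), first paragraph] -/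
structure IsENp (p N : ℕ) (g : ℝ → ℝ) : Prop where
  /-- on `[1,p]`, `g` is a finite maximum of affine maps with integral slopes -/
  exists_rep : ∃ (s : Finset (ℤ × ℝ)) (hs : s.Nonempty), ∀ t ∈ Icc (1 : ℝ) p, g t = ev s hs t
  /-- `f(1) = f(p)` -/
  closed : g 1 = g p
  /-- `-f'₊(1) + p f'₋(p) ≤ N` -/
  order_le : -derivWithin g (Ioi (1 : ℝ)) 1 + (p : ℝ) * derivWithin g (Iio (p : ℝ)) p ≤ N

section Rep

variable {p N : ℕ} {g : ℝ → ℝ} {s : Finset (ℤ × ℝ)} {hs : s.Nonempty}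

/-- A represented function is affine just right of `1`, with slope `slopeMax s 1`. [cite: ConnesConsani2017ScalingSite, Lemma 5.19 (i) (the right slope f'₊(1))] -/
theorem eventually_right_one (hp : 1 < p) (hrep : ∀ t ∈ Icc (1 : ℝ) p, g t = ev s hs t) :
    ∀ᶠ t in 𝓝[>] (1 : ℝ), g t = g 1 + (slopeMax s hs 1 : ℝ) * (t - 1) := by
  have hp' : (1 : ℝ) < p := by exact_mod_cast hp
  have hI : Ioo (1 : ℝ) p ∈ 𝓝[>] (1 : ℝ) := Ioo_mem_nhdsGT hp'
  filter_upwards [eventually_right s hs 1, hI] with t ht htI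
  rw [hrep t ⟨htI.1.le, htI.2.le⟩, hrep 1 ⟨le_rfl, hp'.le⟩, ht]

/-- A represented function is affine just left of `p`, with slope `slopeMin s p`. [cite: ConnesConsani2017ScalingSite, Lemma 5.19 (i) (the left slope f'₋(p))] -/
theorem eventually_left_p (hp : 1 < p) (hrep : ∀ t ∈ Icc (1 : ℝ) p, g t = ev s hs t) :
    ∀ᶠ t in 𝓝[<] (p : ℝ), g t = g p + (slopeMin s hs p : ℝ) * (t - p) := by
  have hp' : (1 : ℝ) < p := by exact_mod_cast hp
  have hI : Ioo (1 : ℝ) p ∈ 𝓝[<] (p : ℝ) := Ioo_mem_nhdsLT hp'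
  filter_upwards [eventually_left s hs p, hI] with t ht htI
  rw [hrep t ⟨htI.1.le, htI.2.le⟩, hrep p ⟨hp'.le, le_rfl⟩, ht]

/-- `f'₊(1) = slopeMax s 1` (an integer). [cite: ConnesConsani2017ScalingSite, Lemma 5.19 (i) (f'₊(1) is an integral slope)] -/
theorem derivWithin_one (hp : 1 < p) (hrep : ∀ t ∈ Icc (1 : ℝ) p, g t = ev s hs t) :
    derivWithin g (Ioi (1 : ℝ)) 1 = slopeMax s hs 1 :=
  derivWithin_Ioi_eq (eventually_right_one hp hrep)

/-- `f'₋(p) = slopeMin s p` (an integer). [cite: ConnesConsani2017ScalingSite, Lemma 5.19 (i) (f'₋(p) is an integral slope)] -/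
theorem derivWithin_p (hp : 1 < p) (hrep : ∀ t ∈ Icc (1 : ℝ) p, g t = ev s hs t) :
    derivWithin g (Iio (p : ℝ)) p = slopeMin s hs p :=
  derivWithin_Iio_eq (eventually_left_p hp hrep)

/-- Supporting line at `1`: `f(1) + f'₊(1) (z - 1) ≤ f(z)` on `[1,p]` (convexity). [cite: ConnesConsani2017ScalingSite, App. A (first display, v = 1)] -/
theorem support_one (hp : 1 < p) (hrep : ∀ t ∈ Icc (1 : ℝ) p, g t = ev s hs t) :
    ∀ z ∈ Icc (1 : ℝ) p, g 1 + (slopeMax s hs 1 : ℝ) * (z - 1) ≤ g z := by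
  intro z hz
  obtain ⟨q, hq, hq1, hqs⟩ := exists_active_slopeMax s hs 1
  have := support hs hq hq1 z
  rw [hrep z hz, hrep 1 ⟨le_rfl, by exact_mod_cast hp.le⟩, ← hqs]
  exact this

/-- Supporting line at `p`: `f(p) + f'₋(p) (z - p) ≤ f(z)` on `[1,p]` (convexity). [cite: ConnesConsani2017ScalingSite, App. A (first display, v = p)] -/
theorem support_p (hp : 1 < p) (hrep : ∀ t ∈ Icc (1 : ℝ) p, g t = ev s hs t) :
    ∀ z ∈ Icc (1 : ℝ) p, g p + (slopeMin s hs p : ℝ) * (z - p) ≤ g z := by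
  intro z hz
  obtain ⟨q, hq, hq1, hqs⟩ := exists_active_slopeMin s hs p
  have := support hs hq hq1 z
  rw [hrep z hz, hrep p ⟨by exact_mod_cast hp.le, le_rfl⟩, ← hqs]
  exact this

/-- Supporting line at any `x ∈ [1,p]` with an integral slope (convexity, integral slopes).
[cite: ConnesConsani2017ScalingSite, App. A (first display; at a kink any value between f'₋(v) ≤ f'₊(v))] -/
theorem support_at (hrep : ∀ t ∈ Icc (1 : ℝ) p, g t = ev s hs t) {x : ℝ} (hx : x ∈ Icc (1 : ℝ) p) :
    ∃ m : ℤ, ∀ z ∈ Icc (1 : ℝ) p, g x + (m : ℝ) * (z - x) ≤ g z := by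
  obtain ⟨q, hq, hqx⟩ := exists_active s hs x
  refine ⟨q.1, fun z hz => ?_⟩
  have := support hs hq hqx z
  rw [hrep z hz, hrep x hx]
  exact this

end Rep

/-- `f'₊(1) ≤ 0` for a function with `f(1) = f(p)` lying above its supporting line at `1`.
[cite: ConnesConsani2017ScalingSite, Lemma 6.3 (i) (proof: "using the equality f(1)=f(p) one has α ≥ 0")] -/
theorem slope_one_nonpos {p : ℕ} (hp : 1 < p) {f : ℝ → ℝ} {D₁ : ℤ} (hclosed : f 1 = f p)
    (K₁ : ∀ z ∈ Icc (1 : ℝ) p, f 1 + (D₁ : ℝ) * (z - 1) ≤ f z) : D₁ ≤ 0 := by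
  have hp' : (1 : ℝ) < p := by exact_mod_cast hp
  have h := K₁ p ⟨hp'.le, le_rfl⟩
  by_contra hcon
  have h1 : (1 : ℝ) ≤ D₁ := by exact_mod_cast (show 1 ≤ D₁ by omega)
  nlinarith [mul_nonneg (sub_nonneg.2 h1) (sub_nonneg.2 hp'.le)]

/-- `0 ≤ f'₋(p)` for a function with `f(1) = f(p)` lying above its supporting line at `p`.
[cite: ConnesConsani2017ScalingSite, Lemma 6.3 (i) (proof: "using f(1)=f(p) one has β ≥ 0")] -/
theorem slope_p_nonneg {p : ℕ} (hp : 1 < p) {f : ℝ → ℝ} {D₂ : ℤ} (hclosed : f 1 = f p)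
    (K₂ : ∀ z ∈ Icc (1 : ℝ) p, f p + (D₂ : ℝ) * (z - p) ≤ f z) : 0 ≤ D₂ := by
  have hp' : (1 : ℝ) < p := by exact_mod_cast hp
  have h := K₂ 1 ⟨le_rfl, hp'.le⟩
  by_contra hcon
  have h1 : (D₂ : ℝ) ≤ -1 := by exact_mod_cast (show D₂ ≤ -1 by omega)
  nlinarith [mul_nonneg (show (0 : ℝ) ≤ -1 - D₂ by linarith) (sub_nonneg.2 hp'.le)]

/-! ## The functions `φ_a` and the maps `γ_a`, `σ` -/

/-- `b := E((N - a)/p)` (integer part), the second slope of `φ_a`; throughout `a ≤ N`, so the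
natural-number subtraction is the true difference. [cite: ConnesConsani2017ScalingSite, Lemma 5.19 (ii)] -/
def bOf (p N a : ℕ) : ℕ := (N - a) / p

/-- **`φ_a(x) := max{-a(x-1), b(x-p)}`**, `b = E((N-a)/p)`, for `x ∈ [1,p]` (Lemma 5.19 (ii),
there for `a ∈ {1, …, N-p}`; Prop. 6.2 uses `0 ≤ a ≤ N - p`, and `φ_0 = 0` on `[1,p]`).
[cite: ConnesConsani2017ScalingSite, Lemma 5.19 (ii)] -/
def phi (p N a : ℕ) (t : ℝ) : ℝ := max (-(a : ℝ) * (t - 1)) ((bOf p N a : ℝ) * (t - p))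

/-- `φ_a(1) = 0`. [cite: ConnesConsani2017ScalingSite, Lemma 5.19 (ii)] -/
theorem phi_one {p : ℕ} (N a : ℕ) (hp : 1 ≤ p) : phi p N a 1 = 0 := by
  have hp' : (1 : ℝ) ≤ p := by exact_mod_cast hp
  have : (bOf p N a : ℝ) * (1 - p) ≤ 0 :=
    mul_nonpos_of_nonneg_of_nonpos (Nat.cast_nonneg _) (by linarith)
  unfold phi
  rw [sub_self, mul_zero]
  exact max_eq_left this

/-- `φ_a(p) = 0`. [cite: ConnesConsani2017ScalingSite, Lemma 5.19 (ii)] -/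
theorem phi_p {p : ℕ} (N a : ℕ) (hp : 1 ≤ p) : phi p N a p = 0 := by
  have hp' : (1 : ℝ) ≤ p := by exact_mod_cast hp
  have : -(a : ℝ) * (p - 1) ≤ 0 := by
    have : (0 : ℝ) ≤ (a : ℝ) * (p - 1) := mul_nonneg (Nat.cast_nonneg _) (by linarith)
    linarith
  unfold phi
  rw [sub_self, mul_zero]
  exact max_eq_right this

/-- `φ_a ≤ 0` on `[1,p]`. [cite: ConnesConsani2017ScalingSite, Lemma 5.19 (ii)] -/
theorem phi_nonpos {p : ℕ} (N a : ℕ) {t : ℝ} (ht : t ∈ Icc (1 : ℝ) p) : phi p N a t ≤ 0 := by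
  unfold phi
  refine max_le ?_ ?_
  · have : (0 : ℝ) ≤ (a : ℝ) * (t - 1) := mul_nonneg (Nat.cast_nonneg _) (by linarith [ht.1])
    linarith
  · exact mul_nonpos_of_nonneg_of_nonpos (Nat.cast_nonneg _) (by linarith [ht.2])

/-- For `a + p ≤ N` the second slope `b = E((N-a)/p)` is `≥ 1`. [cite: ConnesConsani2017ScalingSite, Lemma 5.19 (ii)] -/
theorem one_le_bOf {p N a : ℕ} (hp : 1 ≤ p) (ha : a + p ≤ N) : 1 ≤ bOf p N a := by
  unfold bOf
  exact (Nat.le_div_iff_mul_le (by omega)).2 (by omega)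

/-- Just right of `1`, `φ_a(t) = -a(t-1)` (for `a + p ≤ N`, `p > 1`). [cite: ConnesConsani2017ScalingSite, Lemma 5.19 (iii) (proof)] -/
theorem phi_eventually_one {p N a : ℕ} (hp : 1 < p) (ha : a + p ≤ N) :
    ∀ᶠ t in 𝓝[>] (1 : ℝ), phi p N a t = -(a : ℝ) * (t - 1) := by
  have hp' : (1 : ℝ) < p := by exact_mod_cast hp
  have hb : (1 : ℝ) ≤ bOf p N a := by exact_mod_cast one_le_bOf hp.le ha
  have hlt : (bOf p N a : ℝ) * (1 - p) < -(a : ℝ) * (1 - 1) := by nlinarith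
  have hc : ∀ᶠ t in 𝓝 (1 : ℝ), (bOf p N a : ℝ) * (t - p) < -(a : ℝ) * (t - 1) :=
    ContinuousAt.eventually_lt (f := fun t => (bOf p N a : ℝ) * (t - p))
      (g := fun t => -(a : ℝ) * (t - 1)) (by fun_prop) (by fun_prop) hlt
  exact (hc.filter_mono nhdsWithin_le_nhds).mono fun t ht => by
    unfold phi
    exact max_eq_left ht.le

/-- Just left of `p`, `φ_a(t) = b(t-p)` when `a ≥ 1`. [cite: ConnesConsani2017ScalingSite, Lemma 5.19 (ii)] -/
theorem phi_eventually_p {p N a : ℕ} (hp : 1 < p) (ha1 : 1 ≤ a) :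
    ∀ᶠ t in 𝓝[<] (p : ℝ), phi p N a t = (bOf p N a : ℝ) * (t - p) := by
  have hp' : (1 : ℝ) < p := by exact_mod_cast hp
  have ha' : (1 : ℝ) ≤ a := by exact_mod_cast ha1
  have hlt : -(a : ℝ) * ((p : ℝ) - 1) < (bOf p N a : ℝ) * ((p : ℝ) - p) := by nlinarith
  have hc : ∀ᶠ t in 𝓝 (p : ℝ), -(a : ℝ) * (t - 1) < (bOf p N a : ℝ) * (t - p) :=
    ContinuousAt.eventually_lt (f := fun t => -(a : ℝ) * (t - 1))
      (g := fun t => (bOf p N a : ℝ) * (t - p)) (by fun_prop) (by fun_prop) hlt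
  exact (hc.filter_mono nhdsWithin_le_nhds).mono fun t ht => by
    unfold phi
    exact max_eq_right ht.le

/-- `φ_0 = 0` on `(-∞, p]`. [cite: ConnesConsani2017ScalingSite, Prop. 6.2 (the ray of constants)] -/
theorem phi_zero_eq {p : ℕ} (N : ℕ) {t : ℝ} (ht : t ≤ p) : phi p N 0 t = 0 := by
  unfold phi
  have : (bOf p N 0 : ℝ) * (t - p) ≤ 0 :=
    mul_nonpos_of_nonneg_of_nonpos (Nat.cast_nonneg _) (by linarith)
  simpa using this

/-- The two affine maps `t ↦ -a t + a` and `t ↦ b t - b p` whose maximum is `φ_a`. [cite: ConnesConsani2017ScalingSite, Lemma 5.19 (ii)] -/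
def phiRep (p N a : ℕ) : Finset (ℤ × ℝ) :=
  {(-(a : ℤ), (a : ℝ)), ((bOf p N a : ℤ), -((bOf p N a : ℝ) * p))}

/-- The family representing `φ_a` is nonempty. [cite: ConnesConsani2017ScalingSite, Lemma 5.19 (ii)] -/
theorem phiRep_nonempty (p N a : ℕ) : (phiRep p N a).Nonempty := by
  simp [phiRep]

/-- `φ_a` is the maximum of its two affine maps. [cite: ConnesConsani2017ScalingSite, Lemma 5.19 (ii)] -/
theorem ev_phiRep (p N a : ℕ) (t : ℝ) : ev (phiRep p N a) (phiRep_nonempty p N a) t = phi p N a t := by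
  have h1 : lineOf (-(a : ℤ), (a : ℝ)) t = -(a : ℝ) * (t - 1) := by
    unfold lineOf; push_cast; ring
  have h2 : lineOf ((bOf p N a : ℤ), -((bOf p N a : ℝ) * p)) t = (bOf p N a : ℝ) * (t - p) := by
    unfold lineOf; push_cast; ring
  unfold ev phiRep phi
  rw [Finset.sup'_insert (Finset.singleton_nonempty _), Finset.sup'_singleton, h1, h2]

/-- **Lemma 5.19 (ii) / Prop. 6.2**: `φ_a ∈ ℰ_{N,p}` for `0 ≤ a ≤ N - p` (with `f'₊(1) = -a`,
`f'₋(p) = b` for `a ≥ 1`, resp. `0` for `a = 0`, and `a + p b ≤ N`). [cite: ConnesConsani2017ScalingSite, Lemma 5.19 (ii) and Prop. 6.2] -/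
theorem phi_isENp {p N a : ℕ} (hp : 1 < p) (ha : a + p ≤ N) : IsENp p N (phi p N a) := by
  have hp' : (1 : ℝ) < p := by exact_mod_cast hp
  refine ⟨⟨phiRep p N a, phiRep_nonempty p N a, fun t _ => (ev_phiRep p N a t).symm⟩,
    by rw [phi_one N a hp.le, phi_p N a hp.le], ?_⟩
  have d1 : derivWithin (phi p N a) (Ioi (1 : ℝ)) 1 = -(a : ℝ) :=
    derivWithin_Ioi_eq (by
      filter_upwards [phi_eventually_one hp ha] with t ht
      rw [ht, phi_one N a hp.le]; ring)
  rcases Nat.eq_zero_or_pos a with h0 | hpos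
  · subst h0
    have d2 : derivWithin (phi p N 0) (Iio (p : ℝ)) p = 0 :=
      derivWithin_Iio_eq (by
        filter_upwards [self_mem_nhdsWithin] with t ht
        rw [phi_zero_eq N (show t < (p : ℝ) from ht).le, phi_zero_eq N le_rfl]; ring)
    rw [d1, d2]
    simp
  · have d2 : derivWithin (phi p N a) (Iio (p : ℝ)) p = (bOf p N a : ℝ) :=
      derivWithin_Iio_eq (by
        filter_upwards [phi_eventually_p (N := N) hp hpos] with t ht
        rw [ht, phi_p N a hp.le]; ring)
    rw [d1, d2]
    have h1 := Nat.mul_div_le (N - a) p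
    have h2 : ((p * ((N - a) / p) : ℕ) : ℝ) ≤ ((N - a : ℕ) : ℝ) := by exact_mod_cast h1
    rw [Nat.cast_sub (by omega)] at h2
    push_cast at h2
    unfold bOf
    linarith

/-- **`γ_a(f) := -max_{x ∈ [1,p]} (φ_a - f)(x)`**, rendered as the infimum of `f - φ_a` over
`[1,p]` (the same real number). [cite: ConnesConsani2017ScalingSite, App. A, display before Lemma 6.3] -/
def gam (p N : ℕ) (f : ℝ → ℝ) (a : ℕ) : ℝ :=
  sInf ((fun z => f z - phi p N a z) '' Icc (1 : ℝ) p)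

/-- The index set `{0, …, N - p}` of the generators (for `p ≤ N`). [cite: ConnesConsani2017ScalingSite, Prop. 6.2] -/
def idx (p N : ℕ) : Finset ℕ := Finset.range (N + 1 - p)

/-- `a ∈ {0, …, N-p} ↔ a + p ≤ N`. [cite: ConnesConsani2017ScalingSite, Prop. 6.2 (index set {0,…,N-p})] -/
theorem mem_idx {p N : ℕ} (hN : p ≤ N) {a : ℕ} : a ∈ idx p N ↔ a + p ≤ N := by
  simp only [idx, Finset.mem_range]
  omega

/-- `0 ∈ {0, …, N-p}`. [cite: ConnesConsani2017ScalingSite, Prop. 6.2 (index set {0,…,N-p})] -/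
theorem idx_nonempty {p N : ℕ} (hN : p ≤ N) : (idx p N).Nonempty :=
  ⟨0, (mem_idx hN).2 (by simpa using hN)⟩

/-- **`σ : ℝ_max^{N-p+1} → ℰ_{N,p}`, `σ(x) := ∨_a (φ_a + x_a)`** (real coordinates `x_a`,
`a ∈ {0, …, N-p}`). [cite: ConnesConsani2017ScalingSite, Prop. 6.2, eq. (σ)] -/
def sigma (p N : ℕ) (hN : p ≤ N) (x : ℕ → ℝ) (t : ℝ) : ℝ :=
  (idx p N).sup' (idx_nonempty hN) (fun a => phi p N a t + x a)

/-- **Definition 6.1 (extremal elements)**: "`f ∈ ℰ` is extremal iff the equality `f₁ ∨ f₂ = f`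
implies that one of the `f_j = f`", for the `ℝ_max`-module `ℰ_{N,p}` of functions on `[1,p]`
under pointwise `max` (equality of elements = equality on `[1,p]`). [cite: ConnesConsani2017ScalingSite, Def. 6.1 (App. A)] -/
def IsExtremal (p N : ℕ) (f : ℝ → ℝ) : Prop :=
  IsENp p N f ∧ ∀ f₁ f₂ : ℝ → ℝ, IsENp p N f₁ → IsENp p N f₂ →
    (∀ t ∈ Icc (1 : ℝ) p, max (f₁ t) (f₂ t) = f t) →
    (∀ t ∈ Icc (1 : ℝ) p, f₁ t = f t) ∨ (∀ t ∈ Icc (1 : ℝ) p, f₂ t = f t)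

/-! ## Closure properties of `ℰ_{N,p}` -/

/-- `ℰ_{N,p}` is stable under adding a real constant (the `ℝ_max`-action). [cite: ConnesConsani2017ScalingSite, App. A (first paragraph)] -/
theorem IsENp.add_const {p N : ℕ} {g : ℝ → ℝ} (hp : 1 < p) (hg : IsENp p N g) (c : ℝ) :
    IsENp p N (fun t => g t + c) := by
  classical
  obtain ⟨s, hs, hrep⟩ := hg.exists_rep
  refine ⟨?_, by rw [hg.closed], ?_⟩
  · refine ⟨s.image (fun q => (q.1, q.2 + c)), hs.image _, fun t ht => ?_⟩
    rw [hrep t ht]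
    have h1 : ∀ q : ℤ × ℝ, lineOf (q.1, q.2 + c) t = lineOf q t + c := by
      intro q; unfold lineOf; ring
    apply le_antisymm
    · have h2 : ∀ q ∈ s, lineOf q t + c ≤
          (s.image (fun q => (q.1, q.2 + c))).sup' (hs.image _) (fun q => lineOf q t) := by
        intro q hq
        have hmem : (q.1, q.2 + c) ∈ s.image (fun q => (q.1, q.2 + c)) :=
          Finset.mem_image_of_mem _ hq
        have := Finset.le_sup' (fun q => lineOf q t) hmem
        rw [← h1 q]
        exact this
      have h3 : ev s hs t ≤
          (s.image (fun q => (q.1, q.2 + c))).sup' (hs.image _) (fun q => lineOf q t) - c :=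
        Finset.sup'_le _ _ (fun q hq => by linarith [h2 q hq])
      unfold ev at h3 ⊢
      linarith
    · refine Finset.sup'_le _ _ (fun q' hq' => ?_)
      obtain ⟨q, hq, rfl⟩ := Finset.mem_image.1 hq'
      rw [h1 q]
      linarith [lineOf_le_ev hs hq t]
  · have e1 := eventually_right_one hp hrep
    have e2 := eventually_left_p hp hrep
    have d1 : derivWithin (fun t => g t + c) (Ioi (1 : ℝ)) 1 = slopeMax s hs 1 :=
      derivWithin_Ioi_eq (by filter_upwards [e1] with t ht; rw [ht]; ring)
    have d2 : derivWithin (fun t => g t + c) (Iio (p : ℝ)) p = slopeMin s hs p :=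
      derivWithin_Iio_eq (by filter_upwards [e2] with t ht; rw [ht]; ring)
    have := hg.order_le
    rw [derivWithin_one hp hrep, derivWithin_p hp hrep] at this
    rw [d1, d2]
    exact this

/-- `ℰ_{N,p}` is stable under pointwise `max` (`f₁ ∨ f₂`: the module operation).
[cite: ConnesConsani2017ScalingSite, App. A (first paragraph)] -/
theorem IsENp.sup {p N : ℕ} {f₁ f₂ : ℝ → ℝ} (hp : 1 < p) (h₁ : IsENp p N f₁) (h₂ : IsENp p N f₂) :
    IsENp p N (fun t => max (f₁ t) (f₂ t)) := by
  classical
  obtain ⟨s₁, hs₁, hrep₁⟩ := h₁.exists_rep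
  obtain ⟨s₂, hs₂, hrep₂⟩ := h₂.exists_rep
  refine ⟨⟨s₁ ∪ s₂, hs₁.mono Finset.subset_union_left, fun t ht => ?_⟩, ?_, ?_⟩
  · rw [hrep₁ t ht, hrep₂ t ht]
    unfold ev
    rw [Finset.sup'_union hs₁ hs₂]
  · show max (f₁ 1) (f₂ 1) = max (f₁ p) (f₂ p)
    rw [h₁.closed, h₂.closed]
  · have e₁ := eventually_right_one hp hrep₁
    have e₂ := eventually_right_one hp hrep₂
    have l₁ := eventually_left_p hp hrep₁
    have l₂ := eventually_left_p hp hrep₂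
    have o₁ := h₁.order_le
    rw [derivWithin_one hp hrep₁, derivWithin_p hp hrep₁] at o₁
    have o₂ := h₂.order_le
    rw [derivWithin_one hp hrep₂, derivWithin_p hp hrep₂] at o₂
    have hc₁ := h₁.closed
    have hc₂ := h₂.closed
    set A₁ : ℝ := (slopeMax s₁ hs₁ 1 : ℝ) with hA₁
    set A₂ : ℝ := (slopeMax s₂ hs₂ 1 : ℝ) with hA₂
    set B₁ : ℝ := (slopeMin s₁ hs₁ p : ℝ) with hB₁
    set B₂ : ℝ := (slopeMin s₂ hs₂ p : ℝ) with hB₂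
    have hp0 : (0 : ℝ) ≤ p := by positivity
    rcases lt_trichotomy (f₁ 1) (f₂ 1) with hlt | heq | hgt
    · -- `f₁ < f₂` near both ends: the slopes of the max are those of `f₂`
      have hltp : f₁ p < f₂ p := by rw [← hc₁, ← hc₂]; exact hlt
      have ev1 : ∀ᶠ t in 𝓝[>] (1 : ℝ),
          max (f₁ t) (f₂ t) = max (f₁ 1) (f₂ 1) + A₂ * (t - 1) := by
        have hc : ∀ᶠ t in 𝓝 (1 : ℝ), f₁ 1 + A₁ * (t - 1) < f₂ 1 + A₂ * (t - 1) :=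
          ContinuousAt.eventually_lt (f := fun t => f₁ 1 + A₁ * (t - 1))
            (g := fun t => f₂ 1 + A₂ * (t - 1)) (by fun_prop) (by fun_prop) (by simpa using hlt)
        filter_upwards [e₁, e₂, hc.filter_mono nhdsWithin_le_nhds] with t ht₁ ht₂ htc
        rw [ht₁, ht₂, max_eq_right htc.le, max_eq_right hlt.le]
      have evp : ∀ᶠ t in 𝓝[<] (p : ℝ),
          max (f₁ t) (f₂ t) = max (f₁ p) (f₂ p) + B₂ * (t - p) := by
        have hc : ∀ᶠ t in 𝓝 (p : ℝ), f₁ p + B₁ * (t - p) < f₂ p + B₂ * (t - p) :=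
          ContinuousAt.eventually_lt (f := fun t => f₁ p + B₁ * (t - p))
            (g := fun t => f₂ p + B₂ * (t - p)) (by fun_prop) (by fun_prop) (by simpa using hltp)
        filter_upwards [l₁, l₂, hc.filter_mono nhdsWithin_le_nhds] with t ht₁ ht₂ htc
        rw [ht₁, ht₂, max_eq_right htc.le, max_eq_right hltp.le]
      rw [derivWithin_Ioi_eq (g := fun t => max (f₁ t) (f₂ t)) ev1,
        derivWithin_Iio_eq (g := fun t => max (f₁ t) (f₂ t)) evp]
      exact o₂
    · -- equal values at `1` (hence at `p`): slopes `max(A₁,A₂)` at `1`, `min(B₁,B₂)` at `p`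
      have heqp : f₁ p = f₂ p := by rw [← hc₁, ← hc₂]; exact heq
      have ev1 : ∀ᶠ t in 𝓝[>] (1 : ℝ),
          max (f₁ t) (f₂ t) = max (f₁ 1) (f₂ 1) + max A₁ A₂ * (t - 1) := by
        filter_upwards [e₁, e₂, self_mem_nhdsWithin] with t ht₁ ht₂ ht
        have ht' : 0 ≤ t - 1 := by linarith [(show (1 : ℝ) < t from ht).le]
        rw [ht₁, ht₂, heq, max_self, max_add_add_left, max_mul_of_nonneg _ _ ht']
      have evp : ∀ᶠ t in 𝓝[<] (p : ℝ),
          max (f₁ t) (f₂ t) = max (f₁ p) (f₂ p) + min B₁ B₂ * (t - p) := by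
        filter_upwards [l₁, l₂, self_mem_nhdsWithin] with t ht₁ ht₂ ht
        have ht' : t - p ≤ 0 := by linarith [(show t < (p : ℝ) from ht).le]
        rw [ht₁, ht₂, heqp, max_self, max_add_add_left]
        rcases le_total B₁ B₂ with hB | hB
        · rw [min_eq_left hB, max_eq_left (mul_le_mul_of_nonpos_right hB ht')]
        · rw [min_eq_right hB, max_eq_right (mul_le_mul_of_nonpos_right hB ht')]
      rw [derivWithin_Ioi_eq (g := fun t => max (f₁ t) (f₂ t)) ev1,
        derivWithin_Iio_eq (g := fun t => max (f₁ t) (f₂ t)) evp]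
      have h1 : A₁ ≤ max A₁ A₂ := le_max_left _ _
      have h2 : (p : ℝ) * min B₁ B₂ ≤ p * B₁ := mul_le_mul_of_nonneg_left (min_le_left _ _) hp0
      linarith
    · -- `f₂ < f₁` near both ends: the slopes of the max are those of `f₁`
      have hgtp : f₂ p < f₁ p := by rw [← hc₁, ← hc₂]; exact hgt
      have ev1 : ∀ᶠ t in 𝓝[>] (1 : ℝ),
          max (f₁ t) (f₂ t) = max (f₁ 1) (f₂ 1) + A₁ * (t - 1) := by
        have hc : ∀ᶠ t in 𝓝 (1 : ℝ), f₂ 1 + A₂ * (t - 1) < f₁ 1 + A₁ * (t - 1) :=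
          ContinuousAt.eventually_lt (f := fun t => f₂ 1 + A₂ * (t - 1))
            (g := fun t => f₁ 1 + A₁ * (t - 1)) (by fun_prop) (by fun_prop) (by simpa using hgt)
        filter_upwards [e₁, e₂, hc.filter_mono nhdsWithin_le_nhds] with t ht₁ ht₂ htc
        rw [ht₁, ht₂, max_eq_left htc.le, max_eq_left hgt.le]
      have evp : ∀ᶠ t in 𝓝[<] (p : ℝ),
          max (f₁ t) (f₂ t) = max (f₁ p) (f₂ p) + B₁ * (t - p) := by
        have hc : ∀ᶠ t in 𝓝 (p : ℝ), f₂ p + B₂ * (t - p) < f₁ p + B₁ * (t - p) :=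
          ContinuousAt.eventually_lt (f := fun t => f₂ p + B₂ * (t - p))
            (g := fun t => f₁ p + B₁ * (t - p)) (by fun_prop) (by fun_prop) (by simpa using hgtp)
        filter_upwards [l₁, l₂, hc.filter_mono nhdsWithin_le_nhds] with t ht₁ ht₂ htc
        rw [ht₁, ht₂, max_eq_left htc.le, max_eq_left hgtp.le]
      rw [derivWithin_Ioi_eq (g := fun t => max (f₁ t) (f₂ t)) ev1,
        derivWithin_Iio_eq (g := fun t => max (f₁ t) (f₂ t)) evp]
      exact o₁


/-- An affine map is convex. [folklore] -/
private theorem convexOn_lineOf (q : ℤ × ℝ) : ConvexOn ℝ univ (lineOf q) := by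
  refine ⟨convex_univ, fun x _ y _ a b _ _ hab => le_of_eq ?_⟩
  simp only [lineOf, smul_eq_mul]
  linear_combination (-(q.2)) * hab

/-- A finite maximum of affine maps is convex. [cite: ConnesConsani2017ScalingSite, Lemma 5.19 (i) ("convex")] -/
theorem convexOn_ev (s : Finset (ℤ × ℝ)) (hs : s.Nonempty) : ConvexOn ℝ univ (ev s hs) := by
  induction hs using Finset.Nonempty.cons_induction with
  | singleton q =>
    have : ev {q} (Finset.singleton_nonempty q) = lineOf q := by
      funext t; unfold ev; rw [Finset.sup'_singleton]
    rw [this]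
    exact convexOn_lineOf q
  | cons q s hq hs ih =>
    have : ev (Finset.cons q s hq) (Finset.cons_nonempty hq) = (lineOf q) ⊔ (ev s hs) := by
      funext t; unfold ev; rw [Finset.sup'_cons hs]; rfl
    rw [this]
    exact (convexOn_lineOf q).sup ih

/-- Members of `ℰ_{N,p}` are convex on `[1,p]` ("convex … functions on `[1,p]`").
[cite: ConnesConsani2017ScalingSite, Lemma 5.19 (i)] -/
theorem IsENp.convexOn {p N : ℕ} {g : ℝ → ℝ} (hg : IsENp p N g) : ConvexOn ℝ (Icc (1 : ℝ) p) g := by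
  obtain ⟨s, hs, hrep⟩ := hg.exists_rep
  refine ⟨convex_Icc _ _, fun x hx y hy a b ha hb hab => ?_⟩
  rw [hrep x hx, hrep y hy, hrep _ (convex_Icc (1 : ℝ) p hx hy ha hb hab)]
  exact (convexOn_ev s hs).2 (mem_univ _) (mem_univ _) ha hb hab

/-! ## Lemma 6.3 (i): the convexity estimate

The two cases of the printed proof ("`f'(x) ≤ 0`" and "`f'(x) > 0`"), written for a real function
`f` on `[1,p]` satisfying exactly the inequalities the proof uses: `f(1) = f(p)`; the supporting
lines at `1`, at `p` and at `x` with integral slopes `D₁ = f'₊(1)`, `D₂ = f'₋(p)` and `m` (at a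
kink any value between the one-sided slopes); `D₁ ≤ m ≤ D₂` ("since `f` is convex its derivative is
non-decreasing") and `α + pβ ≤ N` with `α = -D₁`, `β = D₂`. -/

/-- Lemma 6.3 (i), case "`f'(x) ≤ 0`": with `a = -f'(x)` one has `a ∈ {0,…,N-p}`, `β ≤ b`,
`φ_a(x) = -a(x-1)` and `f(z) - f(x) ≥ φ_a(z) - φ_a(x)` on `[1,p]`. [cite: ConnesConsani2017ScalingSite, Lemma 6.3 (i) (proof, first case)] -/
theorem lemma_6_3_i_caseA {p N : ℕ} (hp : 1 < p) (hN : p ≤ N) {f : ℝ → ℝ} {x : ℝ}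
    (hx : x ∈ Icc (1 : ℝ) p) {m D₁ D₂ : ℤ} (hclosed : f 1 = f p)
    (hord : -(D₁ : ℝ) + p * D₂ ≤ N)
    (K₂ : ∀ z ∈ Icc (1 : ℝ) p, f p + (D₂ : ℝ) * (z - p) ≤ f z)
    (Kx : ∀ z ∈ Icc (1 : ℝ) p, f x + (m : ℝ) * (z - x) ≤ f z)
    (hm₁ : D₁ ≤ m) (hm : m ≤ 0) (hdeg : D₂ = 0 → m = 0) :
    ∃ a : ℕ, a + p ≤ N ∧ ∀ z ∈ Icc (1 : ℝ) p, phi p N a z - phi p N a x ≤ f z - f x := by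
  have hp' : (1 : ℝ) < p := by exact_mod_cast hp
  obtain ⟨hx1, hxp⟩ := hx
  have hD₂ : 0 ≤ D₂ := slope_p_nonneg hp hclosed K₂
  -- `a := -m ∈ ℕ`, `d := D₂ ∈ ℕ`
  obtain ⟨a, ha⟩ : ∃ a : ℕ, (a : ℤ) = -m := ⟨(-m).toNat, Int.toNat_of_nonneg (by omega)⟩
  have haR : (a : ℝ) = -(m : ℝ) := by exact_mod_cast ha
  obtain ⟨d, hd⟩ : ∃ d : ℕ, (d : ℤ) = D₂ := ⟨D₂.toNat, Int.toNat_of_nonneg hD₂⟩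
  have hdR : (d : ℝ) = (D₂ : ℝ) := by exact_mod_cast hd
  have hm₁R : (D₁ : ℝ) ≤ m := by exact_mod_cast hm₁
  -- `a + p β ≤ N` since `a ≤ α`
  have h_apd : a + p * d ≤ N := by
    have : (a : ℝ) + p * d ≤ N := by rw [haR, hdR]; linarith
    exact_mod_cast this
  have hap : a + p ≤ N := by
    rcases Nat.eq_zero_or_pos d with hd0 | hdpos
    · have hD0 : D₂ = 0 := by rw [← hd, hd0]; simp
      have hm0 := hdeg hD0
      have : a = 0 := by omega
      omega
    · exact le_trans (Nat.add_le_add_left (Nat.le_mul_of_pos_right p hdpos) a) h_apd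
  refine ⟨a, hap, ?_⟩
  -- `β ≤ b = E((N-a)/p)` because `β` is an integer
  have hb_nat : d ≤ bOf p N a := by
    unfold bOf
    refine (Nat.le_div_iff_mul_le (by omega)).2 ?_
    have h1 : p * d + a ≤ N := by rwa [add_comm] at h_apd
    have h2 := Nat.le_sub_of_add_le h1
    rwa [mul_comm] at h2
  have hbR : (D₂ : ℝ) ≤ (bOf p N a : ℝ) := by rw [← hdR]; exact_mod_cast hb_nat
  set b : ℝ := (bOf p N a : ℝ) with hb_def
  have hK1x := Kx 1 ⟨le_rfl, hp'.le⟩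
  have hK2x := K₂ x ⟨hx1, hxp⟩
  -- `a(x-1) ≤ β(p-x) ≤ b(p-x)`, hence `φ_a(x) = -a(x-1)`
  have hax : (a : ℝ) * (x - 1) ≤ (D₂ : ℝ) * (p - x) := by rw [haR]; linarith
  have hphix : phi p N a x = -(a : ℝ) * (x - 1) := by
    unfold phi
    rw [← hb_def]
    apply max_eq_left
    have h1 : (D₂ : ℝ) * (p - x) ≤ b * (p - x) := mul_le_mul_of_nonneg_right hbR (by linarith)
    linarith
  intro z hz
  obtain ⟨hz1, hzp⟩ := hz
  rw [hphix]
  have hKxz := Kx z ⟨hz1, hzp⟩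
  have hK2z := K₂ z ⟨hz1, hzp⟩
  have h2 : b * (z - p) ≤ (D₂ : ℝ) * (z - p) := by
    have : (D₂ : ℝ) * (p - z) ≤ b * (p - z) := mul_le_mul_of_nonneg_right hbR (by linarith)
    linarith
  have hphi_le : phi p N a z ≤ f z - f x - (a : ℝ) * (x - 1) := by
    unfold phi
    rw [← hb_def]
    rw [haR]
    apply max_le
    · linarith [hKxz]
    · linarith [hK2z, h2, hK1x, hclosed]
  linarith [hphi_le]

/-- Lemma 6.3 (i), case "`f'(x) > 0`": with `a = N - p f'(x)` one has `a ∈ {0,…,N-p}`, `b = f'(x)`,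
`φ_a(x) = b(x-p)` and `f(z) - f(x) ≥ φ_a(z) - φ_a(x)` on `[1,p]`. [cite: ConnesConsani2017ScalingSite, Lemma 6.3 (i) (proof, second case)] -/
theorem lemma_6_3_i_caseB {p N : ℕ} (hp : 1 < p) {f : ℝ → ℝ} {x : ℝ}
    (hx : x ∈ Icc (1 : ℝ) p) {m D₁ D₂ : ℤ} (hclosed : f 1 = f p)
    (hord : -(D₁ : ℝ) + p * D₂ ≤ N)
    (K₁ : ∀ z ∈ Icc (1 : ℝ) p, f 1 + (D₁ : ℝ) * (z - 1) ≤ f z)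
    (Kx : ∀ z ∈ Icc (1 : ℝ) p, f x + (m : ℝ) * (z - x) ≤ f z)
    (hm : 0 < m) (hm₂ : m ≤ D₂) :
    ∃ a : ℕ, a + p ≤ N ∧ ∀ z ∈ Icc (1 : ℝ) p, phi p N a z - phi p N a x ≤ f z - f x := by
  have hp' : (1 : ℝ) < p := by exact_mod_cast hp
  have hp0 : (0 : ℝ) ≤ p := by positivity
  obtain ⟨hx1, hxp⟩ := hx
  have hD₁ : D₁ ≤ 0 := slope_one_nonpos hp hclosed K₁
  have hD₁R : (D₁ : ℝ) ≤ 0 := by exact_mod_cast hD₁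
  obtain ⟨n, hn⟩ : ∃ n : ℕ, (n : ℤ) = m := ⟨m.toNat, Int.toNat_of_nonneg hm.le⟩
  have hn1 : 1 ≤ n := by omega
  have hnR : (n : ℝ) = (m : ℝ) := by exact_mod_cast hn
  have hmD : (p : ℝ) * m ≤ p * D₂ := mul_le_mul_of_nonneg_left (by exact_mod_cast hm₂) hp0
  -- `p f'(x) ≤ p β ≤ N + D₁ ≤ N`
  have hpn : p * n ≤ N := by
    have : (p : ℝ) * n ≤ N := by rw [hnR]; linarith
    exact_mod_cast this
  -- `a := N - p f'(x)`
  obtain ⟨a, haN⟩ : ∃ a : ℕ, a + p * n = N := ⟨N - p * n, Nat.sub_add_cancel hpn⟩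
  have haR : (a : ℝ) = N - p * m := by
    have : (a : ℝ) + p * n = N := by exact_mod_cast haN
    rw [hnR] at this
    linarith
  have hap : a + p ≤ N := by
    calc a + p ≤ a + p * n := Nat.add_le_add_left (Nat.le_mul_of_pos_right p (by omega)) a
      _ = N := haN
  -- `b = E((N-a)/p) = f'(x)`
  have hb : bOf p N a = n := by
    unfold bOf
    have : N - a = p * n := Nat.sub_eq_of_eq_add (by rw [add_comm] at haN; exact haN.symm)
    rw [this, Nat.mul_div_cancel_left n (by omega)]
  have hbR : (bOf p N a : ℝ) = m := by rw [hb]; exact hnR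
  -- `α ≤ a`
  have hD₁a : -(D₁ : ℝ) ≤ a := by rw [haR]; linarith
  refine ⟨a, hap, ?_⟩
  have hK1x := K₁ x ⟨hx1, hxp⟩
  have hKxp := Kx p ⟨hp'.le, le_rfl⟩
  -- `b(p-x) ≤ α(x-1) ≤ a(x-1)`, hence `φ_a(x) = b(x-p)`
  have hphix : phi p N a x = (m : ℝ) * (x - p) := by
    unfold phi
    rw [hbR]
    apply max_eq_right
    have h1 : -(D₁ : ℝ) * (x - 1) ≤ a * (x - 1) := mul_le_mul_of_nonneg_right hD₁a (by linarith)
    linarith [hK1x, hKxp, hclosed]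
  intro z hz
  obtain ⟨hz1, hzp⟩ := hz
  rw [hphix]
  have hKxz := Kx z ⟨hz1, hzp⟩
  have hK1z := K₁ z ⟨hz1, hzp⟩
  have hphi_le : phi p N a z ≤ f z - f x + (m : ℝ) * (x - p) := by
    unfold phi
    rw [hbR]
    apply max_le
    · have h1 : -(D₁ : ℝ) * (z - 1) ≤ a * (z - 1) := mul_le_mul_of_nonneg_right hD₁a (by linarith)
      linarith [hK1z, hKxp, hclosed]
    · linarith [hKxz]
  linarith [hphi_le]

/-- **Lemma 6.3 (i)** (the printed statement): "Let `f ∈ ℰ_{N,p}` and `x ∈ (1,p)`. Then there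
exists `a ∈ {0, …, N-p}` such that `f(z) - f(x) ≥ φ_a(z) - φ_a(x)` for all `z ∈ [1,p]`."
(`p` prime in the source; only `1 < p` is used; `p ≤ N` as in `{0, …, N-p}`.)
[cite: ConnesConsani2017ScalingSite, Lemma 6.3 (i) (App. A)] -/
theorem ConnesConsani2017_lemma_6_3_i {p N : ℕ} (hp : 1 < p) (hN : p ≤ N) {f : ℝ → ℝ}
    (hf : IsENp p N f) {x : ℝ} (hx : x ∈ Ioo (1 : ℝ) p) :
    ∃ a : ℕ, a + p ≤ N ∧ ∀ z ∈ Icc (1 : ℝ) p, phi p N a z - phi p N a x ≤ f z - f x := by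
  obtain ⟨s, hs, hrep⟩ := hf.exists_rep
  have hp' : (1 : ℝ) < p := by exact_mod_cast hp
  have hxI : x ∈ Icc (1 : ℝ) p := ⟨hx.1.le, hx.2.le⟩
  have hord : -(slopeMax s hs 1 : ℝ) + p * (slopeMin s hs p : ℝ) ≤ N := by
    have := hf.order_le
    rw [derivWithin_one hp hrep, derivWithin_p hp hrep] at this
    exact this
  have K₁ := support_one hp hrep
  have K₂ := support_p hp hrep
  obtain ⟨q, hq, hqx⟩ := exists_active s hs x
  have Kx : ∀ z ∈ Icc (1 : ℝ) p, f x + (q.1 : ℝ) * (z - x) ≤ f z := by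
    intro z hz
    have := support hs hq hqx z
    rw [hrep z hz, hrep x hxI]
    exact this
  -- "since `f` is convex its derivative is non-decreasing": `D₁ ≤ m ≤ D₂`
  have hm₁ : slopeMax s hs 1 ≤ q.1 := by
    have h1 := Kx 1 ⟨le_rfl, hp'.le⟩
    have h2 := K₁ x hxI
    by_contra hcon
    have : (q.1 : ℝ) + 1 ≤ slopeMax s hs 1 := by exact_mod_cast (show q.1 + 1 ≤ slopeMax s hs 1 by omega)
    nlinarith [hx.1, mul_nonneg (show (0:ℝ) ≤ slopeMax s hs 1 - q.1 - 1 by linarith) (sub_nonneg.2 hx.1.le)]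
  have hm₂ : q.1 ≤ slopeMin s hs p := by
    have h1 := Kx p ⟨hp'.le, le_rfl⟩
    have h2 := K₂ x hxI
    by_contra hcon
    have : (slopeMin s hs p : ℝ) + 1 ≤ q.1 := by exact_mod_cast (show slopeMin s hs p + 1 ≤ q.1 by omega)
    nlinarith [hx.2, mul_nonneg (show (0:ℝ) ≤ q.1 - slopeMin s hs p - 1 by linarith) (sub_nonneg.2 hx.2.le)]
  -- if `β = 0` then `f` is constant and `m = 0`
  have hdeg : slopeMin s hs p = 0 → q.1 = 0 := by
    intro h0
    have h1 := Kx 1 ⟨le_rfl, hp'.le⟩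
    have h2 := Kx p ⟨hp'.le, le_rfl⟩
    have h3 := K₂ x hxI
    rw [h0] at h3
    push_cast at h3
    have hcl := hf.closed
    have hge : (0 : ℝ) ≤ q.1 := by
      by_contra hcon
      push Not at hcon
      have : (0 : ℝ) < (q.1 : ℝ) * (1 - x) := mul_pos_of_neg_of_neg hcon (by linarith [hx.1])
      linarith
    have hle : (q.1 : ℝ) ≤ 0 := by
      by_contra hcon
      push Not at hcon
      have : (0 : ℝ) < (q.1 : ℝ) * (p - x) := mul_pos hcon (by linarith [hx.2])
      linarith
    exact_mod_cast le_antisymm hle hge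
  rcases le_or_gt q.1 0 with hm | hm
  · exact lemma_6_3_i_caseA hp hN hxI hf.closed hord K₂ Kx hm₁ hm hdeg
  · exact lemma_6_3_i_caseB hp hxI hf.closed hord K₁ Kx hm hm₂

/-- Lemma 6.3 (i) at the end point `x = 1` (same proof with `m = f'₊(1)`; used for Lemma 6.3 (ii)
at the end points, where the source argues on `(1,p)`). [cite: ConnesConsani2017ScalingSite, Lemma 6.3 (i)–(ii) (App. A)] -/
theorem lemma_6_3_i_one {p N : ℕ} (hp : 1 < p) (hN : p ≤ N) {f : ℝ → ℝ} (hf : IsENp p N f) :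
    ∃ a : ℕ, a + p ≤ N ∧ ∀ z ∈ Icc (1 : ℝ) p, phi p N a z - phi p N a 1 ≤ f z - f 1 := by
  obtain ⟨s, hs, hrep⟩ := hf.exists_rep
  have hp' : (1 : ℝ) < p := by exact_mod_cast hp
  have hord : -(slopeMax s hs 1 : ℝ) + p * (slopeMin s hs p : ℝ) ≤ N := by
    have := hf.order_le
    rw [derivWithin_one hp hrep, derivWithin_p hp hrep] at this
    exact this
  have K₁ := support_one hp hrep
  have K₂ := support_p hp hrep
  have hD₁ : slopeMax s hs 1 ≤ 0 := slope_one_nonpos hp hf.closed K₁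
  have hD₂ : 0 ≤ slopeMin s hs p := slope_p_nonneg hp hf.closed K₂
  have hdeg : slopeMin s hs p = 0 → slopeMax s hs 1 = 0 := by
    intro h0
    have hev := eventually_right_one hp hrep
    have hI : Ioo (1 : ℝ) p ∈ 𝓝[>] (1 : ℝ) := Ioo_mem_nhdsGT hp'
    have hE : ∀ᶠ t in 𝓝[>] (1 : ℝ),
        f t = f 1 + (slopeMax s hs 1 : ℝ) * (t - 1) ∧ t ∈ Ioo (1 : ℝ) p := by
      filter_upwards [hev, hI] with t h1 h2
      exact ⟨h1, h2⟩
    obtain ⟨t, ht, htI⟩ := hE.exists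
    have h3 := K₂ t ⟨htI.1.le, htI.2.le⟩
    rw [h0] at h3
    push_cast at h3
    have hcl := hf.closed
    by_contra hcon
    have : (slopeMax s hs 1 : ℝ) ≤ -1 := by exact_mod_cast (show slopeMax s hs 1 ≤ -1 by omega)
    nlinarith [htI.1, mul_nonneg (show (0:ℝ) ≤ -1 - slopeMax s hs 1 by linarith) (sub_nonneg.2 htI.1.le)]
  exact lemma_6_3_i_caseA hp hN ⟨le_rfl, hp'.le⟩ hf.closed hord K₂ K₁ le_rfl hD₁ hdeg

/-- Lemma 6.3 (i) on the CLOSED interval: for every `x ∈ [1,p]` there is `a ∈ {0,…,N-p}` with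
`f(z) - f(x) ≥ φ_a(z) - φ_a(x)` on `[1,p]` (at `x = p` use `f(p) = f(1)`, `φ_a(p) = φ_a(1) = 0`).
[cite: ConnesConsani2017ScalingSite, Lemma 6.3 (i)–(ii) (App. A)] -/
theorem lemma_6_3_i_Icc {p N : ℕ} (hp : 1 < p) (hN : p ≤ N) {f : ℝ → ℝ} (hf : IsENp p N f)
    {x : ℝ} (hx : x ∈ Icc (1 : ℝ) p) :
    ∃ a : ℕ, a + p ≤ N ∧ ∀ z ∈ Icc (1 : ℝ) p, phi p N a z - phi p N a x ≤ f z - f x := by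
  rcases eq_or_lt_of_le hx.1 with h1 | h1
  · rw [← h1]
    exact lemma_6_3_i_one hp hN hf
  rcases eq_or_lt_of_le hx.2 with h2 | h2
  · obtain ⟨a, ha, h⟩ := lemma_6_3_i_one hp hN hf
    refine ⟨a, ha, fun z hz => ?_⟩
    have := h z hz
    rw [h2, phi_p N a hp.le, ← hf.closed]
    rw [phi_one N a hp.le] at this
    exact this
  · exact ConnesConsani2017_lemma_6_3_i hp hN hf ⟨h1, h2⟩

/-! ## Lemma 6.3 (ii) and Proposition 6.2 -/

/-- `f - φ_a` is bounded below on `[1,p]` (so `γ_a(f)` is a genuine infimum). [cite: ConnesConsani2017ScalingSite, Lemma 6.3 (ii) (proof: γ_a(f) is the largest t with φ_a + t ≤ f)] -/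
theorem bddBelow_sub_phi {p N : ℕ} (hp : 1 < p) {f : ℝ → ℝ} (hf : IsENp p N f) (a : ℕ) :
    BddBelow ((fun z => f z - phi p N a z) '' Icc (1 : ℝ) p) := by
  obtain ⟨s, hs, hrep⟩ := hf.exists_rep
  have K₁ := support_one hp hrep
  have hD₁ : (slopeMax s hs 1 : ℝ) ≤ 0 := by exact_mod_cast slope_one_nonpos hp hf.closed K₁
  refine ⟨f 1 + (slopeMax s hs 1 : ℝ) * (p - 1), ?_⟩
  rintro _ ⟨z, hz, rfl⟩
  have h1 := K₁ z hz
  have h2 := phi_nonpos N a hz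
  have h3 : (slopeMax s hs 1 : ℝ) * (p - 1) ≤ (slopeMax s hs 1 : ℝ) * (z - 1) :=
    mul_le_mul_of_nonpos_left (by linarith [hz.2]) hD₁
  show f 1 + _ ≤ f z - phi p N a z
  linarith

/-- `φ_a + γ_a(f) ≤ f` on `[1,p]` ("for `t = γ_a(f)` one has `φ_a + t ≤ f`"). [cite: ConnesConsani2017ScalingSite, Lemma 6.3 (ii) (proof)] -/
theorem phi_add_gam_le {p N : ℕ} (hp : 1 < p) {f : ℝ → ℝ} (hf : IsENp p N f) (a : ℕ) {x : ℝ}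
    (hx : x ∈ Icc (1 : ℝ) p) : phi p N a x + gam p N f a ≤ f x := by
  have h := csInf_le (bddBelow_sub_phi hp hf a) ⟨x, hx, rfl⟩
  unfold gam
  dsimp only at h
  linarith

/-- At every `x ∈ [1,p]` some generator is tight: `f(x) = φ_a(x) + γ_a(f)` with
`γ_a(f) = f(x) - φ_a(x)`. [cite: ConnesConsani2017ScalingSite, Lemma 6.3 (ii) (proof)] -/
theorem exists_eq_phi_add_gam {p N : ℕ} (hp : 1 < p) (hN : p ≤ N) {f : ℝ → ℝ} (hf : IsENp p N f)
    {x : ℝ} (hx : x ∈ Icc (1 : ℝ) p) : ∃ a : ℕ, a + p ≤ N ∧ f x = phi p N a x + gam p N f a := by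
  obtain ⟨a, ha, h⟩ := lemma_6_3_i_Icc hp hN hf hx
  refine ⟨a, ha, le_antisymm ?_ (phi_add_gam_le hp hf a hx)⟩
  have hne : ((fun z => f z - phi p N a z) '' Icc (1 : ℝ) p).Nonempty := ⟨_, ⟨x, hx, rfl⟩⟩
  have : f x - phi p N a x ≤ gam p N f a := by
    unfold gam
    refine le_csInf hne ?_
    rintro _ ⟨z, hz, rfl⟩
    have := h z hz
    show f x - phi p N a x ≤ f z - phi p N a z
    linarith
  linarith

/-- **Lemma 6.3 (ii)**: "Let `f ∈ ℰ_{N,p}`, then `f = ∨_a (φ_a + γ_a(f))`" — as functions on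
`[1,p]`, `a` over `{0, …, N-p}`. [cite: ConnesConsani2017ScalingSite, Lemma 6.3 (ii) (App. A)] -/
theorem ConnesConsani2017_lemma_6_3_ii {p N : ℕ} (hp : 1 < p) (hN : p ≤ N) {f : ℝ → ℝ}
    (hf : IsENp p N f) : ∀ t ∈ Icc (1 : ℝ) p, f t = sigma p N hN (gam p N f) t := by
  intro t ht
  apply le_antisymm
  · obtain ⟨a, ha, h⟩ := exists_eq_phi_add_gam hp hN hf ht
    rw [h]
    exact Finset.le_sup' (fun a => phi p N a t + gam p N f a) ((mem_idx hN).2 ha)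
  · exact Finset.sup'_le _ _ (fun a _ => phi_add_gam_le hp hf a ht)

/-- **Proposition 6.2 (generation)**: "These elements generate the module `ℰ_{N,p}`, the following
map is surjective: `σ : ℝ_max^{N-p+1} → ℰ_{N,p}`, `σ(x) := ∨ (φ_a + x_a)`" — every `f ∈ ℰ_{N,p}`
is `σ(x)` on `[1,p]` for `x = γ(f)`. [cite: ConnesConsani2017ScalingSite, Prop. 6.2 (App. A)] -/
theorem ConnesConsani2017_prop_6_2_surjective {p N : ℕ} (hp : 1 < p) (hN : p ≤ N) {f : ℝ → ℝ}
    (hf : IsENp p N f) : ∃ x : ℕ → ℝ, ∀ t ∈ Icc (1 : ℝ) p, f t = sigma p N hN x t :=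
  ⟨gam p N f, ConnesConsani2017_lemma_6_3_ii hp hN hf⟩

/-- `σ(x) ∈ ℰ_{N,p}` for real coordinates `x` (finite maxima of rays are in the module).
[cite: ConnesConsani2017ScalingSite, Prop. 6.2 (App. A)] -/
theorem sigma_isENp {p N : ℕ} (hp : 1 < p) (hN : p ≤ N) (x : ℕ → ℝ) :
    IsENp p N (sigma p N hN x) := by
  -- finite maxima of members are members, by induction over the index set
  have key : ∀ (J : Finset ℕ) (hJ : J.Nonempty), J ⊆ idx p N →
      IsENp p N (fun t => J.sup' hJ (fun a => phi p N a t + x a)) := by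
    intro J hJ
    induction hJ using Finset.Nonempty.cons_induction with
    | singleton a =>
      intro hsub
      have ha : a + p ≤ N := (mem_idx hN).1 (hsub (Finset.mem_singleton_self a))
      have : (fun t => ({a} : Finset ℕ).sup' (Finset.singleton_nonempty a)
          (fun a => phi p N a t + x a)) = fun t => phi p N a t + x a := by
        funext t; rw [Finset.sup'_singleton]
      rw [this]
      exact (phi_isENp hp ha).add_const hp (x a)
    | cons a J haJ hJ ih =>
      intro hsub
      have ha : a + p ≤ N := (mem_idx hN).1 (hsub (Finset.mem_cons_self a J))
      have hsubJ : J ⊆ idx p N := fun y hy => hsub (Finset.mem_cons.2 (Or.inr hy))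
      have : (fun t => (Finset.cons a J haJ).sup' (Finset.cons_nonempty haJ)
          (fun a => phi p N a t + x a)) =
          fun t => max (phi p N a t + x a) (J.sup' hJ (fun a => phi p N a t + x a)) := by
        funext t; rw [Finset.sup'_cons hJ]
      rw [this]
      exact ((phi_isENp hp ha).add_const hp (x a)).sup hp (ih hsubJ)
  exact key (idx p N) (idx_nonempty hN) subset_rfl

/-- The algebra of "one of the `f_j` agrees with `φ_a` in a neighborhood of `λ = 1`": two affine
germs `v_j + A_j (t - 1)` whose maximum is `c - a(t-1)` at `t = 1` and at two further points
`1 < t₂ < t₁` — one of them IS `c - a(t-1)`. [cite: ConnesConsani2017ScalingSite, Prop. 6.2 (proof)] -/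
theorem germ_eq_of_max_eq {c a A₁ A₂ v₁ v₂ t₁ t₂ : ℝ} (ht₂ : 1 < t₂) (h₁₂ : t₂ < t₁)
    (h0 : max v₁ v₂ = c)
    (h1 : max (v₁ + A₁ * (t₁ - 1)) (v₂ + A₂ * (t₁ - 1)) = c + -a * (t₁ - 1))
    (h2 : max (v₁ + A₁ * (t₂ - 1)) (v₂ + A₂ * (t₂ - 1)) = c + -a * (t₂ - 1)) :
    (v₁ = c ∧ A₁ = -a) ∨ (v₂ = c ∧ A₂ = -a) := by
  have hv₁ : v₁ ≤ c := by rw [← h0]; exact le_max_left _ _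
  have hv₂ : v₂ ≤ c := by rw [← h0]; exact le_max_right _ _
  have u₁t₁ : v₁ + A₁ * (t₁ - 1) ≤ c + -a * (t₁ - 1) := by rw [← h1]; exact le_max_left _ _
  have u₂t₁ : v₂ + A₂ * (t₁ - 1) ≤ c + -a * (t₁ - 1) := by rw [← h1]; exact le_max_right _ _
  have u₁t₂ : v₁ + A₁ * (t₂ - 1) ≤ c + -a * (t₂ - 1) := by rw [← h2]; exact le_max_left _ _
  have u₂t₂ : v₂ + A₂ * (t₂ - 1) ≤ c + -a * (t₂ - 1) := by rw [← h2]; exact le_max_right _ _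
  rcases max_eq_iff.1 h0 with ⟨hv, -⟩ | ⟨hv, -⟩
  · -- `v₁ = c`
    by_cases hA : A₁ = -a
    · exact Or.inl ⟨hv, hA⟩
    · right
      have hAlt : A₁ < -a := by
        rcases lt_or_gt_of_ne hA with h | h
        · exact h
        · exfalso
          have : -a * (t₁ - 1) < A₁ * (t₁ - 1) := mul_lt_mul_of_pos_right h (by linarith)
          linarith
      -- the first germ is strictly below at `t₁`, `t₂`, so the second one is tight there
      have s₁ : v₁ + A₁ * (t₁ - 1) < c + -a * (t₁ - 1) := by
        have : A₁ * (t₁ - 1) < -a * (t₁ - 1) := mul_lt_mul_of_pos_right hAlt (by linarith)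
        linarith
      have s₂ : v₁ + A₁ * (t₂ - 1) < c + -a * (t₂ - 1) := by
        have : A₁ * (t₂ - 1) < -a * (t₂ - 1) := mul_lt_mul_of_pos_right hAlt (by linarith)
        linarith
      have e₁ : v₂ + A₂ * (t₁ - 1) = c + -a * (t₁ - 1) := by
        rcases max_eq_iff.1 h1 with ⟨h, -⟩ | ⟨h, -⟩
        · exact absurd h s₁.ne
        · exact h
      have e₂ : v₂ + A₂ * (t₂ - 1) = c + -a * (t₂ - 1) := by
        rcases max_eq_iff.1 h2 with ⟨h, -⟩ | ⟨h, -⟩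
        · exact absurd h s₂.ne
        · exact h
      have hprod : (A₂ + a) * (t₁ - t₂) = 0 := by linarith
      rcases mul_eq_zero.1 hprod with h | h
      · have hA₂ : A₂ = -a := by linarith
        refine ⟨by rw [hA₂] at e₁; linarith, hA₂⟩
      · exact absurd (by linarith : t₁ = t₂) (ne_of_gt h₁₂)
  · -- `v₂ = c` (symmetric)
    by_cases hA : A₂ = -a
    · exact Or.inr ⟨hv, hA⟩
    · left
      have hAlt : A₂ < -a := by
        rcases lt_or_gt_of_ne hA with h | h
        · exact h
        · exfalso
          have : -a * (t₁ - 1) < A₂ * (t₁ - 1) := mul_lt_mul_of_pos_right h (by linarith)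
          linarith
      have s₁ : v₂ + A₂ * (t₁ - 1) < c + -a * (t₁ - 1) := by
        have : A₂ * (t₁ - 1) < -a * (t₁ - 1) := mul_lt_mul_of_pos_right hAlt (by linarith)
        linarith
      have s₂ : v₂ + A₂ * (t₂ - 1) < c + -a * (t₂ - 1) := by
        have : A₂ * (t₂ - 1) < -a * (t₂ - 1) := mul_lt_mul_of_pos_right hAlt (by linarith)
        linarith
      have e₁ : v₁ + A₁ * (t₁ - 1) = c + -a * (t₁ - 1) := by
        rcases max_eq_iff.1 h1 with ⟨h, -⟩ | ⟨h, -⟩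
        · exact h
        · exact absurd h s₁.ne
      have e₂ : v₁ + A₁ * (t₂ - 1) = c + -a * (t₂ - 1) := by
        rcases max_eq_iff.1 h2 with ⟨h, -⟩ | ⟨h, -⟩
        · exact h
        · exact absurd h s₂.ne
      have hprod : (A₁ + a) * (t₁ - t₂) = 0 := by linarith
      rcases mul_eq_zero.1 hprod with h | h
      · have hA₁ : A₁ = -a := by linarith
        refine ⟨by rw [hA₁] at e₁; linarith, hA₁⟩
      · exact absurd (by linarith : t₁ = t₂) (ne_of_gt h₁₂)

/-- The second half of the extremality argument: a member `f ≤ φ_a + c` with `f(1) = c` and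
`f'₊(1) = -a` equals `φ_a + c` on `[1,p]` ("comparing the slopes one gets `ℓ = a` and `t_a = 0`.
Thus `f₁ ≥ φ_a`"; here directly from the supporting lines at `1` and `p` and `β ≤ b`).
[cite: ConnesConsani2017ScalingSite, Prop. 6.2 (proof)] -/
theorem eq_phi_of_le_of_germ {p N a : ℕ} (hp : 1 < p) {f : ℝ → ℝ} {c : ℝ}
    {s : Finset (ℤ × ℝ)} {hs : s.Nonempty} (hf : IsENp p N f)
    (hrep : ∀ t ∈ Icc (1 : ℝ) p, f t = ev s hs t)
    (hle : ∀ t ∈ Icc (1 : ℝ) p, f t ≤ phi p N a t + c) (hf1 : f 1 = c)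
    (hD : slopeMax s hs 1 = -(a : ℤ)) : ∀ t ∈ Icc (1 : ℝ) p, f t = phi p N a t + c := by
  have K₁ := support_one hp hrep
  have K₂ := support_p hp hrep
  have hord := hf.order_le
  rw [derivWithin_one hp hrep, derivWithin_p hp hrep, hD] at hord
  push_cast at hord
  have hD₂ : 0 ≤ slopeMin s hs p := slope_p_nonneg hp hf.closed K₂
  obtain ⟨d, hd⟩ : ∃ d : ℕ, (d : ℤ) = slopeMin s hs p := ⟨_, Int.toNat_of_nonneg hD₂⟩
  have hdR : (d : ℝ) = (slopeMin s hs p : ℝ) := by exact_mod_cast hd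
  have h_apd : a + p * d ≤ N := by
    have : (a : ℝ) + p * d ≤ N := by rw [hdR]; linarith
    exact_mod_cast this
  have hb_nat : d ≤ bOf p N a := by
    unfold bOf
    refine (Nat.le_div_iff_mul_le (by omega)).2 ?_
    have h1 : p * d + a ≤ N := by rwa [add_comm] at h_apd
    have h2 := Nat.le_sub_of_add_le h1
    rwa [mul_comm] at h2
  have hbR : (slopeMin s hs p : ℝ) ≤ (bOf p N a : ℝ) := by rw [← hdR]; exact_mod_cast hb_nat
  have hcl := hf.closed
  intro t ht
  apply le_antisymm (hle t ht)
  have h1 := K₁ t ht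
  rw [hD] at h1
  push_cast at h1
  have h2 := K₂ t ht
  have h3 : (bOf p N a : ℝ) * (t - p) ≤ (slopeMin s hs p : ℝ) * (t - p) := by
    have := mul_le_mul_of_nonneg_right hbR (show (0 : ℝ) ≤ p - t by linarith [ht.2])
    linarith
  show phi p N a t + c ≤ f t
  unfold phi
  rcases le_total (-(a : ℝ) * (t - 1)) ((bOf p N a : ℝ) * (t - p)) with hm | hm
  · rw [max_eq_right hm]; linarith
  · rw [max_eq_left hm]; linarith

/-- **Proposition 6.2 (extremality)**: "The functions `φ_a`, for `0 ≤ a ≤ N-p`, are extremal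
elements of `ℰ_{N,p}`" — and so is every element `φ_a + c` of their rays.
[cite: ConnesConsani2017ScalingSite, Prop. 6.2 (App. A)] -/
theorem ConnesConsani2017_prop_6_2_extremal {p N a : ℕ} (hp : 1 < p) (ha : a + p ≤ N) (c : ℝ) :
    IsExtremal p N (fun t => phi p N a t + c) := by
  refine ⟨(phi_isENp hp ha).add_const hp c, fun f₁ f₂ h₁ h₂ hmax0 => ?_⟩
  have hp' : (1 : ℝ) < p := by exact_mod_cast hp
  have hmax : ∀ t ∈ Icc (1 : ℝ) p, max (f₁ t) (f₂ t) = phi p N a t + c := by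
    intro t ht
    have := hmax0 t ht
    beta_reduce at this
    exact this
  show (∀ t ∈ Icc (1 : ℝ) p, f₁ t = phi p N a t + c) ∨ (∀ t ∈ Icc (1 : ℝ) p, f₂ t = phi p N a t + c)
  obtain ⟨s₁, hs₁, hrep₁⟩ := h₁.exists_rep
  obtain ⟨s₂, hs₂, hrep₂⟩ := h₂.exists_rep
  have e₁ := eventually_right_one hp hrep₁
  have e₂ := eventually_right_one hp hrep₂
  have ephi := phi_eventually_one hp ha
  have hI : Ioo (1 : ℝ) p ∈ 𝓝[>] (1 : ℝ) := Ioo_mem_nhdsGT hp'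
  -- two points `1 < t₂ < t₁ < p` where both germs and `φ_a` are affine
  have hE : ∀ᶠ t in 𝓝[>] (1 : ℝ),
      (f₁ t = f₁ 1 + (slopeMax s₁ hs₁ 1 : ℝ) * (t - 1) ∧
        f₂ t = f₂ 1 + (slopeMax s₂ hs₂ 1 : ℝ) * (t - 1)) ∧
      (phi p N a t = -(a : ℝ) * (t - 1) ∧ t ∈ Ioo (1 : ℝ) p) := by
    filter_upwards [e₁, e₂, ephi, hI] with t h1 h2 h3 h4
    exact ⟨⟨h1, h2⟩, h3, h4⟩
  obtain ⟨t₁, ⟨h1t₁, h2t₁⟩, hphit₁, ht₁⟩ := hE.exists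
  have hE' : ∀ᶠ t in 𝓝[>] (1 : ℝ), ((f₁ t = f₁ 1 + (slopeMax s₁ hs₁ 1 : ℝ) * (t - 1) ∧
        f₂ t = f₂ 1 + (slopeMax s₂ hs₂ 1 : ℝ) * (t - 1)) ∧
      (phi p N a t = -(a : ℝ) * (t - 1) ∧ t ∈ Ioo (1 : ℝ) p)) ∧ t ∈ Ioo (1 : ℝ) t₁ := by
    filter_upwards [hE, Ioo_mem_nhdsGT ht₁.1] with t h1 h2
    exact ⟨h1, h2⟩
  obtain ⟨t₂, ⟨⟨h1t₂, h2t₂⟩, hphit₂, ht₂⟩, ht₂₁⟩ := hE'.exists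
  -- the maximum of the two germs is `φ_a + c` at `1`, `t₁`, `t₂`
  have hm0 := hmax 1 ⟨le_rfl, hp'.le⟩
  rw [phi_one N a hp.le, zero_add] at hm0
  have hm1 := hmax t₁ ⟨ht₁.1.le, ht₁.2.le⟩
  rw [h1t₁, h2t₁, hphit₁] at hm1
  have hm2 := hmax t₂ ⟨ht₂.1.le, ht₂.2.le⟩
  rw [h1t₂, h2t₂, hphit₂] at hm2
  have hle₁ : ∀ t ∈ Icc (1 : ℝ) p, f₁ t ≤ phi p N a t + c :=
    fun t ht => by rw [← hmax t ht]; exact le_max_left _ _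
  have hle₂ : ∀ t ∈ Icc (1 : ℝ) p, f₂ t ≤ phi p N a t + c :=
    fun t ht => by rw [← hmax t ht]; exact le_max_right _ _
  rcases germ_eq_of_max_eq ht₂₁.1 ht₂₁.2 hm0 (by rw [hm1]; ring) (by rw [hm2]; ring) with
    ⟨hv, hA⟩ | ⟨hv, hA⟩
  · left
    have hA' : slopeMax s₁ hs₁ 1 = -(a : ℤ) := by exact_mod_cast hA
    exact eq_phi_of_le_of_germ hp h₁ hrep₁ hle₁ hv hA'
  · right
    have hA' : slopeMax s₂ hs₂ 1 = -(a : ℤ) := by exact_mod_cast hA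
    exact eq_phi_of_le_of_germ hp h₂ hrep₂ hle₂ hv hA'

/-- **Proposition 6.2 (the extremal rays)**: "the elements of the set `{φ_a + x ∣ x ∈ ℝ_max}` are
the extremal rays of `ℰ_{N,p}`" — an element of `ℰ_{N,p}` is extremal iff it is `φ_a + c` on
`[1,p]` for some `a ∈ {0,…,N-p}` and `c ∈ ℝ` ("the equality `f = ∨(φ_a + γ_a(f))` shows that any
extremal element is of the form `φ_a + t`"). [cite: ConnesConsani2017ScalingSite, Prop. 6.2 (App. A)] -/
theorem ConnesConsani2017_prop_6_2_extremal_iff {p N : ℕ} (hp : 1 < p) (hN : p ≤ N) {f : ℝ → ℝ} :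
    IsExtremal p N f ↔
      IsENp p N f ∧ ∃ (a : ℕ) (c : ℝ), a + p ≤ N ∧ ∀ t ∈ Icc (1 : ℝ) p, f t = phi p N a t + c := by
  constructor
  · rintro ⟨hfE, hext⟩
    refine ⟨hfE, ?_⟩
    -- `f = ∨_{a ∈ J} (φ_a + γ_a(f))` for `J = {0,…,N-p}`; split off one generator at a time
    have claim : ∀ (J : Finset ℕ) (hJ : J.Nonempty), J ⊆ idx p N →
        (∀ t ∈ Icc (1 : ℝ) p, f t = J.sup' hJ (fun a => phi p N a t + gam p N f a)) →
        ∃ a ∈ J, ∀ t ∈ Icc (1 : ℝ) p, f t = phi p N a t + gam p N f a := by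
      intro J hJ
      induction hJ using Finset.Nonempty.cons_induction with
      | singleton a =>
        intro _ h
        exact ⟨a, Finset.mem_singleton_self a, fun t ht => by rw [h t ht, Finset.sup'_singleton]⟩
      | cons a J haJ hJ ih =>
        intro hsub h
        have ha : a + p ≤ N := (mem_idx hN).1 (hsub (Finset.mem_cons_self a J))
        have hsubJ : J ⊆ idx p N := fun y hy => hsub (Finset.mem_cons.2 (Or.inr hy))
        have hga : IsENp p N (fun t => phi p N a t + gam p N f a) :=
          (phi_isENp hp ha).add_const hp _
        have hGJ : IsENp p N (fun t => J.sup' hJ (fun a => phi p N a t + gam p N f a)) := by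
          have := sigma_isENp hp hN (gam p N f)
          -- restrict the induction used there to `J`: redo it directly
          clear this
          have key : ∀ (J : Finset ℕ) (hJ : J.Nonempty), J ⊆ idx p N →
              IsENp p N (fun t => J.sup' hJ (fun a => phi p N a t + gam p N f a)) := by
            intro J hJ
            induction hJ using Finset.Nonempty.cons_induction with
            | singleton a =>
              intro hsub
              have ha : a + p ≤ N := (mem_idx hN).1 (hsub (Finset.mem_singleton_self a))
              have : (fun t => ({a} : Finset ℕ).sup' (Finset.singleton_nonempty a)
                  (fun a => phi p N a t + gam p N f a)) = fun t => phi p N a t + gam p N f a := by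
                funext t; rw [Finset.sup'_singleton]
              rw [this]
              exact (phi_isENp hp ha).add_const hp _
            | cons a J haJ hJ ih =>
              intro hsub
              have ha : a + p ≤ N := (mem_idx hN).1 (hsub (Finset.mem_cons_self a J))
              have hsubJ : J ⊆ idx p N := fun y hy => hsub (Finset.mem_cons.2 (Or.inr hy))
              have : (fun t => (Finset.cons a J haJ).sup' (Finset.cons_nonempty haJ)
                  (fun a => phi p N a t + gam p N f a)) = fun t =>
                  max (phi p N a t + gam p N f a)
                    (J.sup' hJ (fun a => phi p N a t + gam p N f a)) := by
                funext t; rw [Finset.sup'_cons hJ]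
              rw [this]
              exact ((phi_isENp hp ha).add_const hp _).sup hp (ih hsubJ)
          exact key J hJ hsubJ
        have hmax' : ∀ t ∈ Icc (1 : ℝ) p, max (phi p N a t + gam p N f a)
            (J.sup' hJ (fun a => phi p N a t + gam p N f a)) = f t := by
          intro t ht
          rw [h t ht, Finset.sup'_cons hJ]
        rcases hext _ _ hga hGJ hmax' with h1 | h1
        · exact ⟨a, Finset.mem_cons_self a J, fun t ht => (h1 t ht).symm⟩
        · obtain ⟨a', ha', h'⟩ := ih hsubJ (fun t ht => (h1 t ht).symm)
          exact ⟨a', Finset.mem_cons.2 (Or.inr ha'), h'⟩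
    obtain ⟨a, ha, h⟩ :=
      claim (idx p N) (idx_nonempty hN) subset_rfl (ConnesConsani2017_lemma_6_3_ii hp hN hfE)
    exact ⟨a, gam p N f a, (mem_idx hN).1 ha, h⟩
  · rintro ⟨hfE, a, c, ha, h⟩
    refine ⟨hfE, fun f₁ f₂ h₁ h₂ hmax => ?_⟩
    have hmax' : ∀ t ∈ Icc (1 : ℝ) p, max (f₁ t) (f₂ t) = phi p N a t + c :=
      fun t ht => by rw [hmax t ht, h t ht]
    rcases (ConnesConsani2017_prop_6_2_extremal hp ha c).2 f₁ f₂ h₁ h₂ hmax' with h1 | h1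
    · exact Or.inl fun t ht => by rw [h1 t ht, h t ht]
    · exact Or.inr fun t ht => by rw [h1 t ht, h t ht]


/-! ## The literal description implies membership

The printed words of Lemma 5.19 (i) taken literally — break points `1 = x₀ < x₁ < … < x_{n+1} = p`,
an INTEGRAL slope `s_j` on each piece `[x_j, x_{j+1}]`, continuity (adjacent pieces share their
end values), convexity (`s_j ≤ s_{j+1}`), `f(1) = f(p)` and `-f'₊(1) + p f'₋(p) ≤ N` with
`f'₊(1) = s₀`, `f'₋(p) = s_n` — imply membership in `IsENp`: the function is, on `[1,p]`, the
maximum of the affine extensions of its pieces (convexity). -/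

/-- Piece data for a convex, continuous, piecewise affine function with integral slopes on `[1,p]`:
break points `1 = x₀ < … < x_{n+1} = p`, integral slopes `s₀ ≤ … ≤ s_n`, `g` affine of slope
`s_j` on `[x_j, x_{j+1}]`. [cite: ConnesConsani2017ScalingSite, Lemma 5.19 (i)] -/
structure PieceData (p : ℕ) (g : ℝ → ℝ) where
  /-- number of interior break points -/
  n : ℕ
  /-- break points `x 0, …, x (n+1)` -/
  x : ℕ → ℝ
  /-- slopes `s 0, …, s n` -/
  s : ℕ → ℤ
  /-- `x₀ = 1` -/
  x_zero : x 0 = 1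
  /-- `x_{n+1} = p` -/
  x_last : x (n + 1) = p
  /-- strictly increasing break points -/
  x_lt : ∀ i, i ≤ n → x i < x (i + 1)
  /-- convexity: non-decreasing slopes -/
  s_mono : ∀ i, i < n → s i ≤ s (i + 1)
  /-- affine of slope `s j` on the `j`-th piece (this includes continuity at the break points) -/
  piece : ∀ j, j ≤ n → ∀ t, x j ≤ t → t ≤ x (j + 1) → g t = g (x j) + (s j : ℝ) * (t - x j)

namespace PieceData

variable {p : ℕ} {g : ℝ → ℝ} (P : PieceData p g)

/-- Break points increase. [folklore] -/
private theorem x_le_of_le {i j : ℕ} (hij : i ≤ j) (hj : j ≤ P.n + 1) : P.x i ≤ P.x j := by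
  induction j with
  | zero =>
    have : i = 0 := Nat.le_zero.1 hij
    subst this; exact le_rfl
  | succ j ih =>
    rcases Nat.lt_or_eq_of_le hij with h | h
    · exact (ih (Nat.lt_succ_iff.1 h) (by omega)).trans (P.x_lt j (by omega)).le
    · rw [h]

/-- Slopes are non-decreasing. [folklore] -/
private theorem s_le_of_le {i j : ℕ} (hij : i ≤ j) (hj : j ≤ P.n) : P.s i ≤ P.s j := by
  induction j with
  | zero =>
    have : i = 0 := Nat.le_zero.1 hij
    subst this; exact le_rfl
  | succ j ih =>
    rcases Nat.lt_or_eq_of_le hij with h | h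
    · exact (ih (Nat.lt_succ_iff.1 h) (by omega)).trans (P.s_mono j (by omega))
    · rw [h]

/-- Values at consecutive break points. [folklore] -/
private theorem val_succ {j : ℕ} (hj : j ≤ P.n) :
    g (P.x (j + 1)) = g (P.x j) + (P.s j : ℝ) * (P.x (j + 1) - P.x j) :=
  P.piece j hj _ (P.x_lt j hj).le le_rfl

/-- Forward comparison of break-point values against the `j`-th affine extension. [folklore] -/
private theorem val_ge_fwd {j : ℕ} (hj : j ≤ P.n) :
    ∀ k, j ≤ k → k ≤ P.n + 1 → g (P.x j) + (P.s j : ℝ) * (P.x k - P.x j) ≤ g (P.x k) := by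
  intro k hjk hk
  induction k with
  | zero =>
    have : j = 0 := Nat.le_zero.1 hjk
    subst this; simp
  | succ k ih =>
    rcases Nat.lt_or_eq_of_le hjk with h | h
    · have hk' : k ≤ P.n := by omega
      have h1 := ih (Nat.lt_succ_iff.1 h) (by omega)
      have h2 := P.val_succ hk'
      have h3 : (P.s j : ℝ) ≤ P.s k := by exact_mod_cast P.s_le_of_le (Nat.lt_succ_iff.1 h) hk'
      have h4 : (P.s j : ℝ) * (P.x (k + 1) - P.x k) ≤ (P.s k : ℝ) * (P.x (k + 1) - P.x k) :=
        mul_le_mul_of_nonneg_right h3 (by linarith [P.x_lt k hk'])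
      rw [h2]
      linarith
    · rw [← h]; simp

/-- Backward comparison of break-point values against the `j`-th affine extension. [folklore] -/
private theorem val_ge_bwd {k : ℕ} :
    ∀ j, k ≤ j → j ≤ P.n → g (P.x j) + (P.s j : ℝ) * (P.x k - P.x j) ≤ g (P.x k) := by
  intro j hkj hj
  induction j with
  | zero =>
    have : k = 0 := Nat.le_zero.1 hkj
    subst this; simp
  | succ j ih =>
    rcases Nat.lt_or_eq_of_le hkj with h | h
    · have hj' : j ≤ P.n := by omega
      have h1 := ih (Nat.lt_succ_iff.1 h) hj'
      have h2 := P.val_succ hj'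
      have h3 : (P.s j : ℝ) ≤ P.s (j + 1) := by exact_mod_cast P.s_mono j (by omega)
      have hxk : P.x k ≤ P.x (j + 1) := P.x_le_of_le (by omega) (by omega)
      have h4 : (P.s j : ℝ) * (P.x (j + 1) - P.x k) ≤ (P.s (j + 1) : ℝ) * (P.x (j + 1) - P.x k) :=
        mul_le_mul_of_nonneg_right h3 (by linarith)
      rw [h2]
      linarith
    · rw [← h]; simp

/-- **Supporting line of a piece**: the affine extension of the `j`-th piece minorises `g` on
`[1,p]` (convexity of a piecewise affine function with non-decreasing slopes).
[cite: ConnesConsani2017ScalingSite, App. A (first display)] -/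
theorem line_le {j : ℕ} (hj : j ≤ P.n) {z : ℝ} (hz : z ∈ Icc (1 : ℝ) p) :
    g (P.x j) + (P.s j : ℝ) * (z - P.x j) ≤ g z := by
  -- locate the piece `k` containing `z`
  classical
  have h0 : P.x 0 ≤ z := by rw [P.x_zero]; exact hz.1
  set k := Nat.findGreatest (fun i => P.x i ≤ z) P.n with hk_def
  have hk : k ≤ P.n := Nat.findGreatest_le _
  have hk1 : P.x k ≤ z := by
    have := Nat.findGreatest_spec (P := fun i => P.x i ≤ z) (Nat.zero_le P.n) h0
    exact this
  have hk2 : z ≤ P.x (k + 1) := by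
    rcases Nat.lt_or_eq_of_le hk with h | h
    · by_contra hcon
      have := Nat.findGreatest_is_greatest (P := fun i => P.x i ≤ z) (Nat.lt_succ_self k) (by omega)
      exact this (le_of_not_ge hcon)
    · rw [h, P.x_last]; exact hz.2
  have hgz := P.piece k hk z hk1 hk2
  rcases le_or_gt j k with hjk | hjk
  · -- `j ≤ k`: compare at `x_k` and use `s_j ≤ s_k`
    have h1 := P.val_ge_fwd hj k hjk (by omega)
    have h3 : (P.s j : ℝ) ≤ P.s k := by exact_mod_cast P.s_le_of_le hjk hk
    have h4 : (P.s j : ℝ) * (z - P.x k) ≤ (P.s k : ℝ) * (z - P.x k) :=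
      mul_le_mul_of_nonneg_right h3 (by linarith)
    rw [hgz]
    linarith
  · -- `k < j`: compare at `x_{k+1}` and use `s_k ≤ s_j`
    have h1 := P.val_ge_bwd j (show k + 1 ≤ j by omega) hj
    have h2 := P.val_succ hk
    have h3 : (P.s k : ℝ) ≤ P.s j := by exact_mod_cast P.s_le_of_le (by omega) hj
    have h4 : (P.s k : ℝ) * (P.x (k + 1) - z) ≤ (P.s j : ℝ) * (P.x (k + 1) - z) :=
      mul_le_mul_of_nonneg_right h3 (by linarith)
    rw [hgz]
    linarith

/-- Every point of `[1,p]` lies on some piece, where `g` is the affine extension of that piece.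
[cite: ConnesConsani2017ScalingSite, Lemma 5.19 (i)] -/
theorem exists_piece {z : ℝ} (hz : z ∈ Icc (1 : ℝ) p) :
    ∃ k, k ≤ P.n ∧ P.x k ≤ z ∧ z ≤ P.x (k + 1) := by
  classical
  have h0 : P.x 0 ≤ z := by rw [P.x_zero]; exact hz.1
  refine ⟨Nat.findGreatest (fun i => P.x i ≤ z) P.n, Nat.findGreatest_le _,
    Nat.findGreatest_spec (P := fun i => P.x i ≤ z) (Nat.zero_le P.n) h0, ?_⟩
  rcases Nat.lt_or_eq_of_le (Nat.findGreatest_le (P := fun i => P.x i ≤ z) P.n) with h | h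
  · by_contra hcon
    exact Nat.findGreatest_is_greatest (P := fun i => P.x i ≤ z) (Nat.lt_succ_self _) (by omega)
      (le_of_not_ge hcon)
  · rw [h, P.x_last]; exact hz.2

/-- The family of affine extensions of the pieces. [cite: ConnesConsani2017ScalingSite, Lemma 5.19 (i)] -/
def rep : Finset (ℤ × ℝ) :=
  (Finset.range (P.n + 1)).image (fun j => (P.s j, g (P.x j) - (P.s j : ℝ) * P.x j))

/-- The family of affine extensions is nonempty. [cite: ConnesConsani2017ScalingSite, Lemma 5.19 (i)] -/
theorem rep_nonempty : P.rep.Nonempty := by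
  unfold rep
  exact (Finset.nonempty_range_iff.2 (Nat.succ_ne_zero _)).image _

/-- On `[1,p]`, `g` is the maximum of the affine extensions of its pieces.
[cite: ConnesConsani2017ScalingSite, Lemma 5.19 (i) with App. A (first display)] -/
theorem eq_ev (z : ℝ) (hz : z ∈ Icc (1 : ℝ) p) : g z = ev P.rep P.rep_nonempty z := by
  classical
  have hline : ∀ j, lineOf (P.s j, g (P.x j) - (P.s j : ℝ) * P.x j) z =
      g (P.x j) + (P.s j : ℝ) * (z - P.x j) := by
    intro j; unfold lineOf; ring
  apply le_antisymm
  · obtain ⟨k, hk, hk1, hk2⟩ := P.exists_piece hz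
    have hmem : (P.s k, g (P.x k) - (P.s k : ℝ) * P.x k) ∈ P.rep := by
      unfold rep
      exact Finset.mem_image_of_mem _ (Finset.mem_range.2 (by omega))
    have h1 := Finset.le_sup' (fun q => lineOf q z) hmem
    rw [hline k, ← P.piece k hk z hk1 hk2] at h1
    exact h1
  · refine Finset.sup'_le _ _ (fun q hq => ?_)
    unfold rep at hq
    obtain ⟨j, hj, rfl⟩ := Finset.mem_image.1 hq
    rw [hline j]
    exact P.line_le (by simpa [Nat.lt_succ_iff] using Finset.mem_range.1 hj) hz

/-- The right slope at `1` is `s₀` and the left slope at `p` is `s_n`.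
[cite: ConnesConsani2017ScalingSite, Lemma 5.19 (i)] -/
theorem derivWithin_eq :
    derivWithin g (Ioi (1 : ℝ)) 1 = P.s 0 ∧ derivWithin g (Iio (p : ℝ)) p = P.s P.n := by
  constructor
  · apply derivWithin_Ioi_eq
    have h01 : (1 : ℝ) < P.x 1 := by rw [← P.x_zero]; exact P.x_lt 0 (Nat.zero_le _)
    filter_upwards [Ioo_mem_nhdsGT h01] with t ht
    have := P.piece 0 (Nat.zero_le _) t (by rw [P.x_zero]; exact ht.1.le) ht.2.le
    rw [P.x_zero] at this
    exact this
  · apply derivWithin_Iio_eq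
    have hn : P.x P.n < p := by rw [← P.x_last]; exact P.x_lt P.n le_rfl
    filter_upwards [Ioo_mem_nhdsLT hn] with t ht
    have h1 := P.piece P.n le_rfl t ht.1.le (by rw [P.x_last]; exact ht.2.le)
    have h2 := P.piece P.n le_rfl (p : ℝ) hn.le (by rw [P.x_last])
    rw [h1, h2]
    ring

end PieceData

/-- **Lemma 5.19 (i), literal reading ⇒ membership**: a function given on `[1,p]` by piece data
(convex, continuous, piecewise affine, integral slopes) with `f(1) = f(p)` and
`-f'₊(1) + p f'₋(p) ≤ N` (`f'₊(1) = s₀`, `f'₋(p) = s_n`) belongs to `ℰ_{N,p}` as rendered by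
`IsENp`. [cite: ConnesConsani2017ScalingSite, Lemma 5.19 (i)] -/
theorem isENp_of_pieceData {p N : ℕ} {g : ℝ → ℝ} (P : PieceData p g)
    (hclosed : g 1 = g p) (hord : -(P.s 0 : ℝ) + p * (P.s P.n : ℝ) ≤ N) : IsENp p N g := by
  obtain ⟨d1, d2⟩ := P.derivWithin_eq
  refine ⟨⟨P.rep, P.rep_nonempty, fun t ht => P.eq_ev t ht⟩, hclosed, ?_⟩
  rw [d1, d2]
  exact hord


/-! ## From the tree's `H⁰((H_p,N))¹` to `ℰ_{N,p}` (Lemma 5.19 (i), direction ⇒)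

The tree's `CpH0Level D ρ` (`ScalingSitePeriodicOrbit.lean`) is `H⁰(D)^ρ = {f ∈ 𝒦(C_p) ∣
D + (f) ≥ 0, ‖f‖_p ≤ ρ}` as a set of real functions on `ℝ₊*` with `f(pλ) = f(λ)`. For the divisor
`D = (H_p, N)` and `ρ = 1` its elements, read on `[1,p]`, are members of `IsENp p N` — this is the
content of Lemma 5.19 (i) in the direction used by Appendix A, obtained from the representation
data of `ScalingSiteH0Param.lean` (`RepData`: break points based at `1`, integral slopes
(Prop. 5.15 (iv)), `D + (f) ≥ 0` at the break points and at `1`). -/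

/-- The divisor `D = (H_p, N)` of `C_p`: value `N` at the point `H_p` (`λ = 1`), zero at the other
points. [cite: ConnesConsani2017ScalingSite, Lemma 5.19 (the divisor (H_p, N))] -/
def divHpN (p : ℕ) (hp : 1 < p) (N : ℕ) : CpDivisor p :=
  CpDivisor.single p hp 1 N one_pos (by
    have h := isPFraction_intCast p (N : ℤ)
    rw [div_one]
    exact_mod_cast h)

/-- A point of `(1,p)` is not in the class `p^ℤ` of `1`. [folklore] -/
private theorem not_inClass_one {p : ℕ} (hp : 1 < p) {b : ℝ} (h1 : 1 < b) (h2 : b < p) :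
    ¬ InClass p 1 b := by
  rintro ⟨k, hk⟩
  rw [mul_one] at hk
  have hpR : (1 : ℝ) ≤ p := by exact_mod_cast hp.le
  rcases le_or_gt k 0 with hk0 | hk0
  · have : (p : ℝ) ^ k ≤ 1 := zpow_le_one_of_nonpos₀ hpR hk0
    linarith
  · have : (p : ℝ) ^ (1 : ℤ) ≤ (p : ℝ) ^ k := zpow_le_zpow_right₀ hpR (by omega)
    rw [zpow_one] at this
    linarith

/-- `(H_p, N)` vanishes at the points `λ ∈ (1,p)`. [cite: ConnesConsani2017ScalingSite, Lemma 5.19 (the divisor (H_p, N))] -/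
theorem divHpN_apply_of_mem_Ioo {p : ℕ} (hp : 1 < p) (N : ℕ) {b : ℝ} (h1 : 1 < b) (h2 : b < p) :
    (divHpN p hp N).toFun b = 0 := by
  rw [divHpN, CpDivisor.single_apply, if_neg (not_inClass_one hp h1 h2)]

/-- `(H_p, N)` takes the value `N` at `λ = 1`. [cite: ConnesConsani2017ScalingSite, Lemma 5.19 (the divisor (H_p, N))] -/
theorem divHpN_apply_one {p : ℕ} (hp : 1 < p) (N : ℕ) : (divHpN p hp N).toFun 1 = N := by
  rw [divHpN, CpDivisor.single_apply, if_pos ⟨0, by simp⟩]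

/-- **Lemma 5.19 (i) (⇒)**: every element of `ℰ_{N,p} := H⁰(D)¹`, `D = (H_p, N)` — in the tree's
rendering `CpH0Level D 1`: `f ∈ 𝒦(C_p)`, `D + (f) ≥ 0`, `‖f‖_p ≤ 1` — is, read on `[1,p]`, a
member of `IsENp p N` ("convex (continuous), piecewise affine functions on `[1,p]` with integral
slopes, such that `f(1) = f(p)` and `-f'₊(1) + p f'₋(p) ≤ N`"). Consequently all results of this
file (Lemma 6.3, Prop. 6.2) apply to the elements of `H⁰((H_p,N))¹`.
[cite: ConnesConsani2017ScalingSite, Lemma 5.19 (i)] -/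
theorem isENp_of_cpH0Level {p : ℕ} [Fact p.Prime] {N : ℕ} (hp : 1 < p)
    (F : CpH0Level (divHpN p hp N) 1) : IsENp p N F.1 := by
  have hF : cpSlopeNorm p F.1 ≤ (p : ℝ) ^ 0 := by simpa only [pow_zero] using F.2.2
  obtain ⟨R⟩ := nonempty_repData (D := divHpN p hp N) (m := 0) ⟨F.1, F.2.1, hF⟩
  let P : PieceData p F.1 :=
    { n := R.T.card
      x := bpts p R.T
      s := R.z
      x_zero := bpts_zero
      x_last := bpts_of_card_lt (Nat.lt_succ_self _)
      x_lt := fun i hi => bpts_lt_succ hp R.hT hi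
      s_mono := by
        intro i hi
        have h1 := R.z_succ_sub_ge (j := i) (by omega)
        have hb := R.hT _ (bpts_mem (p := p) (T := R.T) (i := i + 1) (by omega) (by omega))
        have hD0 : (divHpN p hp N).toFun (bpts p R.T (i + 1)) = 0 :=
          divHpN_apply_of_mem_Ioo hp N hb.1 hb.2
        rw [hD0] at h1
        simp only [mul_zero, zero_div, neg_zero, sub_nonneg] at h1
        exact_mod_cast h1
      piece := by
        intro j hj t h1 h2
        have := R.P.piece j (by rw [R.hPn]; exact hj) t (by rw [R.hPl]; exact h1)
          (by rw [R.hPl]; exact h2)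
        rw [R.hPl, R.hz j hj] at this
        simp only [pow_zero, div_one] at this
        exact this }
  refine isENp_of_pieceData P ?_ ?_
  · have := R.hper 1 one_pos
    rw [mul_one] at this
    exact this.symm
  · have h := R.ordOne_ineq
    rw [divHpN_apply_one hp N] at h
    simp only [pow_zero, one_mul] at h
    show -(R.z 0 : ℝ) + p * (R.z R.T.card : ℝ) ≤ N
    linarith


/-! ## From `ℰ_{N,p}` back to `H⁰((H_p,N))¹` (Lemma 5.19 (i), direction ⇐)

A member `F` of `IsENp p N`, read on `[1,p]`, extends `p`-periodically (`x ↦ F(x̄)`, `x̄` the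
representative of `x` in `[1,p)`) to an element of the tree's `H⁰((H_p,N))¹ = CpH0Level (H_p,N) 1`:
the break points are the crossing points in `(1,p)` of members of the representing family with
distinct slopes (between two consecutive ones a single affine map is active), the slopes are
integers (`‖·‖_p ≤ 1`, Prop. 5.15 (iv)), convexity gives `(f) ≥ 0` at the interior break points and
the order condition gives `N + Ord(f)(1) ≥ 0`. Together with `isENp_of_cpH0Level` this identifies
`IsENp p N` with the restrictions to `[1,p]` of the elements of `H⁰((H_p,N))¹` (Lemma 5.19 (i)). -/

section Converse

variable {p N : ℕ}

/-- The crossing point of two affine maps with distinct slopes. [folklore] -/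
private def cross (q q' : ℤ × ℝ) : ℝ := (q'.2 - q.2) / ((q.1 : ℝ) - q'.1)

/-- Two affine maps with distinct slopes differ by `(m - m')(t - t₀)`, `t₀` their crossing point.
[folklore] -/
private theorem lineOf_sub_lineOf {q q' : ℤ × ℝ} (hne : q.1 ≠ q'.1) (t : ℝ) :
    lineOf q t - lineOf q' t = ((q.1 : ℝ) - q'.1) * (t - cross q q') := by
  have hne' : (q.1 : ℝ) - q'.1 ≠ 0 := sub_ne_zero.2 (by exact_mod_cast hne)
  unfold lineOf cross
  rw [mul_sub, mul_div_cancel₀ _ hne']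
  ring

/-- The candidate break points of a finite maximum of affine maps inside `(1,p)`: crossing points
of pairs of members with distinct slopes. [folklore] -/
private def crossSet (p : ℕ) (s : Finset (ℤ × ℝ)) : Finset ℝ :=
  (((s ×ˢ s).filter (fun qq => qq.1.1 ≠ qq.2.1)).image (fun qq => cross qq.1 qq.2)).filter
    (fun t => 1 < t ∧ t < (p : ℝ))

/-- The candidate break points lie in `(1,p)`. [folklore] -/
private theorem crossSet_bound (s : Finset (ℤ × ℝ)) :
    ∀ t ∈ crossSet p s, 1 < t ∧ t < (p : ℝ) := fun _ ht => (Finset.mem_filter.1 ht).2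

/-- A crossing point in `(1,p)` of two members with distinct slopes is a candidate break point.
[folklore] -/
private theorem cross_mem_crossSet {s : Finset (ℤ × ℝ)} {q q' : ℤ × ℝ} (hq : q ∈ s) (hq' : q' ∈ s)
    (hne : q.1 ≠ q'.1) (h1 : 1 < cross q q') (h2 : cross q q' < (p : ℝ)) :
    cross q q' ∈ crossSet p s := by
  unfold crossSet
  refine Finset.mem_filter.2 ⟨?_, h1, h2⟩
  exact Finset.mem_image.2 ⟨(q, q'), Finset.mem_filter.2 ⟨Finset.mem_product.2 ⟨hq, hq'⟩, hne⟩, rfl⟩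

/-- The member active at the midpoint of the `j`-th piece between consecutive candidate break
points. [folklore] -/
private def qStar (s : Finset (ℤ × ℝ)) (hs : s.Nonempty) (j : ℕ) : ℤ × ℝ :=
  Classical.choose (exists_active s hs ((bpts p (crossSet p s) j + bpts p (crossSet p s) (j + 1)) / 2))

/-- The chosen member is in the family and active at the midpoint. [folklore] -/
private theorem qStar_spec (s : Finset (ℤ × ℝ)) (hs : s.Nonempty) (j : ℕ) :
    qStar (p := p) s hs j ∈ s ∧ lineOf (qStar (p := p) s hs j)
      ((bpts p (crossSet p s) j + bpts p (crossSet p s) (j + 1)) / 2) =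
      ev s hs ((bpts p (crossSet p s) j + bpts p (crossSet p s) (j + 1)) / 2) :=
  let h := Classical.choose_spec
    (exists_active s hs ((bpts p (crossSet p s) j + bpts p (crossSet p s) (j + 1)) / 2))
  ⟨h.1, h.2⟩

/-- **One affine map per piece.** Between consecutive candidate break points the maximum is the
single member active at the midpoint (a member exceeding it somewhere on the piece would cross it
strictly inside the piece). [cite: ConnesConsani2017ScalingSite, Lemma 5.19 (i) ("piecewise affine")] -/
theorem ev_eq_lineOf_qStar (hp : 1 < p) (s : Finset (ℤ × ℝ)) (hs : s.Nonempty) {j : ℕ} (hj : j ≤ (crossSet p s).card) {x : ℝ}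
    (hx1 : bpts p (crossSet p s) j ≤ x) (hx2 : x ≤ bpts p (crossSet p s) (j + 1)) :
    ev s hs x = lineOf (qStar (p := p) s hs j) x := by
  set T := crossSet p s with hTdef
  have hT := crossSet_bound (p := p) s
  set a := bpts p T j with ha
  set b := bpts p T (j + 1) with hb
  set c := (a + b) / 2 with hc
  have hab : a < b := bpts_lt_succ hp hT hj
  have ha1 : 1 ≤ a := one_le_bpts hp hT j
  have hbp : b ≤ p := bpts_le_p hp hT (j + 1)
  obtain ⟨hqs, hqc⟩ := qStar_spec (p := p) s hs j
  set q₀ := qStar (p := p) s hs j with hq₀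
  apply le_antisymm _ (lineOf_le_ev hs hqs x)
  refine Finset.sup'_le _ _ (fun q hq => ?_)
  by_contra hcon
  push Not at hcon
  have hqc' : lineOf q c ≤ lineOf q₀ c := by rw [hqc]; exact lineOf_le_ev hs hq c
  by_cases hsl : q.1 = q₀.1
  · -- parallel members: the difference is constant
    have h1 : lineOf q x - lineOf q₀ x = lineOf q c - lineOf q₀ c := by
      unfold lineOf; rw [show (q.1 : ℝ) = q₀.1 by exact_mod_cast hsl]; ring
    linarith
  · -- distinct slopes: the crossing point lies strictly inside the piece
    have hdx := lineOf_sub_lineOf hsl x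
    have hdc := lineOf_sub_lineOf hsl c
    set t₀ := cross q q₀ with ht₀
    have hpos : 0 < ((q.1 : ℝ) - q₀.1) * (x - t₀) := by linarith
    have hnonpos : ((q.1 : ℝ) - q₀.1) * (c - t₀) ≤ 0 := by linarith
    have hin : a < t₀ ∧ t₀ < b := by
      rcases lt_or_gt_of_ne (sub_ne_zero.2 (show (q.1 : ℝ) ≠ q₀.1 by exact_mod_cast hsl)) with hm | hm
      · -- negative slope difference: `x < t₀ ≤ c`
        have h1 : x - t₀ < 0 := by
          by_contra h; push Not at h
          have := mul_nonpos_of_nonpos_of_nonneg hm.le h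
          linarith
        have h2 : 0 ≤ c - t₀ := by
          by_contra h; push Not at h
          have := mul_pos_of_neg_of_neg hm h
          linarith
        constructor <;> linarith
      · -- positive slope difference: `c ≤ t₀ < x`
        have h1 : 0 < x - t₀ := by
          by_contra h; push Not at h
          have := mul_nonpos_of_nonneg_of_nonpos hm.le h
          linarith
        have h2 : c - t₀ ≤ 0 := by
          by_contra h; push Not at h
          have := mul_pos hm h
          linarith
        constructor <;> linarith
    have hmem : t₀ ∈ T := cross_mem_crossSet hq hqs hsl (by linarith) (by linarith)
    exact not_mem_Ioo_bpts hp hT (Or.inl hmem) hj hin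

/-- The slope of the `j`-th piece. [cite: ConnesConsani2017ScalingSite, Lemma 5.19 (i)] -/
theorem ev_piece_affine (hp : 1 < p) (s : Finset (ℤ × ℝ)) (hs : s.Nonempty) {j : ℕ} (hj : j ≤ (crossSet p s).card) {x : ℝ}
    (hx1 : bpts p (crossSet p s) j ≤ x) (hx2 : x ≤ bpts p (crossSet p s) (j + 1)) :
    ev s hs x = ev s hs (bpts p (crossSet p s) j) +
      ((qStar (p := p) s hs j).1 : ℝ) * (x - bpts p (crossSet p s) j) := by
  rw [ev_eq_lineOf_qStar hp s hs hj hx1 hx2,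
    ev_eq_lineOf_qStar hp s hs hj le_rfl (bpts_lt_succ hp (crossSet_bound s) hj).le]
  exact lineOf_eq _ _ _

/-- Convexity at the break points: consecutive slopes are non-decreasing.
[cite: ConnesConsani2017ScalingSite, Lemma 5.19 (i) ("convex")] -/
theorem qStar_slope_mono (hp : 1 < p) (s : Finset (ℤ × ℝ)) (hs : s.Nonempty) {j : ℕ} (hj : j + 1 ≤ (crossSet p s).card) :
    (qStar (p := p) s hs j).1 ≤ (qStar (p := p) s hs (j + 1)).1 := by
  have hT := crossSet_bound (p := p) s
  set y := bpts p (crossSet p s) (j + 1) with hy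
  set c := (bpts p (crossSet p s) (j + 1) + bpts p (crossSet p s) (j + 2)) / 2 with hc
  have hlt : y < bpts p (crossSet p s) (j + 2) := bpts_lt_succ hp hT hj
  have hyc : y < c := by rw [hc]; linarith
  -- both members are active at `y`
  have h1 : ev s hs y = lineOf (qStar (p := p) s hs j) y :=
    ev_eq_lineOf_qStar hp s hs (by omega) (bpts_lt_succ hp hT (by omega)).le le_rfl
  have h2 : ev s hs c = lineOf (qStar (p := p) s hs (j + 1)) c :=
    ev_eq_lineOf_qStar hp s hs hj hyc.le (by rw [hc]; linarith)
  have h3 : ev s hs y = lineOf (qStar (p := p) s hs (j + 1)) y :=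
    ev_eq_lineOf_qStar hp s hs hj le_rfl hlt.le
  have h4 : lineOf (qStar (p := p) s hs j) c ≤ ev s hs c :=
    lineOf_le_ev hs (qStar_spec (p := p) s hs j).1 c
  have e1 := lineOf_eq (qStar (p := p) s hs j) y c
  have e2 := lineOf_eq (qStar (p := p) s hs (j + 1)) y c
  have key : ((qStar (p := p) s hs j).1 : ℝ) * (c - y) ≤
      ((qStar (p := p) s hs (j + 1)).1 : ℝ) * (c - y) := by linarith
  exact_mod_cast le_of_mul_le_mul_right key (by linarith)

/-- **Lemma 5.19 (i) (⇐)**: a member of `ℰ_{N,p}` (as rendered by `IsENp p N`) is, on `[1,p]`,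
the restriction of an element of the tree's `H⁰((H_p,N))¹ = CpH0Level (H_p,N) 1` — namely of its
`p`-periodic extension `x ↦ F(x̄)`. [cite: ConnesConsani2017ScalingSite, Lemma 5.19 (i)] -/
theorem exists_cpH0Level_of_isENp [Fact p.Prime] (hp : 1 < p) {F : ℝ → ℝ} (hF : IsENp p N F) :
    ∃ G : CpH0Level (divHpN p hp N) 1, ∀ t ∈ Icc (1 : ℝ) p, G.1 t = F t := by
  classical
  obtain ⟨s, hs, hrep⟩ := hF.exists_rep
  have hp0 : 0 < p := zero_lt_one.trans hp
  have hpR : (1 : ℝ) < p := by exact_mod_cast hp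
  have hp0R : (0 : ℝ) < p := by positivity
  set T := crossSet p s with hTdef
  have hT := crossSet_bound (p := p) s
  -- closure of the represented function
  have hclos : ev s hs p = ev s hs 1 := by
    rw [← hrep p ⟨hpR.le, le_rfl⟩, ← hrep 1 ⟨le_rfl, hpR.le⟩, hF.closed]
  -- slopes and the periodic extension
  set sl : ℕ → ℤ := fun j => (qStar (p := p) s hs j).1 with hsl
  set g : ℝ → ℝ := fun x => ev s hs (fundRed p 1 x) with hgdef
  have hg : ∀ x, 0 < x → g x = ev s hs (fundRed p 1 x) := fun x _ => rfl
  have haff : ∀ j, j ≤ T.card → ∀ x, bpts p T j ≤ x → x ≤ bpts p T (j + 1) →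
      ev s hs x = ev s hs (bpts p T j) + ((sl j : ℤ) : ℝ) * (x - bpts p T j) :=
    fun j hj x hx1 hx2 => ev_piece_affine hp s hs hj hx1 hx2
  let P : CpPieces p g := CpPieces.ofFinset hp T hT hg hclos (fun j => ((sl j : ℤ) : ℝ))
    (fun j _ => isPFraction_intCast p (sl j)) haff
  have hper : ∀ x, 0 < x → g (p * x) = g x := by
    intro x hx
    simp only [hgdef, fundRed_mul_p hp one_pos hx]
  have hrat : IsCpRational p g := P.isCpRational hper
  -- values on `[1,p]`
  have hgF : ∀ t ∈ Icc (1 : ℝ) p, g t = F t := by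
    intro t ht
    rcases lt_or_eq_of_le ht.2 with hlt | heq
    · simp only [hgdef]
      rw [fundRed_of_mem hp one_pos ht.1 (by simpa using hlt), hrep t ht]
    · simp only [hgdef]
      rw [heq, fundRed_one_p hp, ← hclos, ← heq, hrep t ht]
  -- the divisor condition `D + (g) ≥ 0`
  have hone : -((sl 0 : ℤ) : ℝ) + p * ((sl T.card : ℤ) : ℝ) ≤ N := by
    have d1 : derivWithin F (Ioi (1 : ℝ)) 1 = ((sl 0 : ℤ) : ℝ) := by
      apply derivWithin_Ioi_eq
      have h01 : (1 : ℝ) < bpts p T 1 := by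
        have := bpts_lt_succ hp hT (Nat.zero_le T.card); rwa [bpts_zero] at this
      filter_upwards [Ioo_mem_nhdsGT h01] with t ht
      have htp : t ≤ p := ht.2.le.trans (bpts_le_p hp hT 1)
      have h := haff 0 (Nat.zero_le _) t (by rw [bpts_zero]; exact ht.1.le) ht.2.le
      rw [bpts_zero] at h
      rw [hrep t ⟨ht.1.le, htp⟩, hrep 1 ⟨le_rfl, hpR.le⟩, h]
    have d2 : derivWithin F (Iio (p : ℝ)) p = ((sl T.card : ℤ) : ℝ) := by
      apply derivWithin_Iio_eq
      have hn : bpts p T T.card < p := by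
        have := bpts_lt_succ hp hT (le_refl T.card)
        rwa [bpts_of_card_lt (Nat.lt_succ_self _)] at this
      filter_upwards [Ioo_mem_nhdsLT hn] with t ht
      have ht1 : 1 ≤ t := (one_le_bpts hp hT T.card).trans ht.1.le
      have h1 := haff T.card le_rfl t ht.1.le (by rw [bpts_of_card_lt (Nat.lt_succ_self _)]; exact ht.2.le)
      have h2 := haff T.card le_rfl (p : ℝ) hn.le (by rw [bpts_of_card_lt (Nat.lt_succ_self _)])
      rw [hrep t ⟨ht1, ht.2.le⟩, hrep p ⟨hpR.le, le_rfl⟩, h1, h2]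
      ring
    have := hF.order_le
    rw [d1, d2] at this
    exact this
  have hdiv : ∀ x, 0 < x → 0 ≤ (divHpN p hp N).toFun x + cpOrder g x := by
    intro x hx
    obtain ⟨k, y, hy0, hy1, rfl⟩ := exists_zpow_mul_mem_Ico hp one_pos hx
    have hy1' : y < (p : ℝ) := by simpa using hy1
    have hyP0 : P.lam 0 ≤ y := by show bpts p T 0 ≤ y; rw [bpts_zero]; exact hy0
    have hyP1 : y < P.lam (P.n + 1) := by
      show y < bpts p T (T.card + 1); rw [bpts_of_card_lt (Nat.lt_succ_self _)]; exact hy1'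
    rw [(divHpN p hp N).apply_zpow_mul hp0 (lt_of_lt_of_le one_pos hy0) k,
      P.cpOrder_zpow_mul hp0 hper hyP0 hyP1 k]
    rcases eq_or_lt_of_le hy0 with h1 | h1
    · -- `y = 1`: `N + Ord(g)(1) = N + (sl 0 - p sl_n) ≥ 0`
      rw [← h1, divHpN_apply_one hp N]
      have := P.cpOrder_lam_zero hp0 hper
      have hl0 : P.lam 0 = 1 := by show bpts p T 0 = 1; exact bpts_zero
      rw [hl0, one_mul] at this
      rw [this]
      show (0 : ℝ) ≤ N + (((sl 0 : ℤ) : ℝ) - p * ((sl T.card : ℤ) : ℝ))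
      linarith
    · rw [divHpN_apply_of_mem_Ioo hp N h1 hy1', zero_add]
      by_cases h0 : cpOrder g y = 0
      · rw [h0]
      · obtain ⟨j, hj, hjy⟩ := P.eq_lam_of_cpOrder_ne_zero hyP0 hyP1 h0
        obtain ⟨i, rfl⟩ : ∃ i, j = i + 1 := by
          rcases Nat.eq_zero_or_pos j with h | h
          · exfalso; rw [h] at hjy
            have : y = 1 := by rw [hjy]; show bpts p T 0 = 1; exact bpts_zero
            linarith
          · exact ⟨j - 1, by omega⟩
        rw [hjy, P.cpOrder_lam_succ hj]
        have hmono : ((sl i : ℤ) : ℝ) ≤ ((sl (i + 1) : ℤ) : ℝ) := by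
          exact_mod_cast qStar_slope_mono hp s hs (j := i) hj
        have hlpos : 0 < P.lam (i + 1) := P.lam_pos.trans_le
          (le_of_lt (P.lam_lt_of_lt (Nat.zero_lt_succ i) (by omega)))
        exact mul_nonneg hlpos.le (by show (0:ℝ) ≤ ((sl (i+1) : ℤ) : ℝ) - ((sl i : ℤ) : ℝ); linarith)
  -- the `p`-adic size of the slopes
  have hnorm : cpSlopeNorm p g ≤ 1 := by
    have := CpPieces.cpSlopeNorm_le_of_h_eq hrat P rfl rfl (m := 0) sl
      (fun j _ => by rw [pow_zero, div_one]; rfl)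
    simpa using this
  exact ⟨⟨g, ⟨hrat, hdiv⟩, hnorm⟩, hgF⟩

end Converse

/-- `IsENp` only depends on the values on `[1,p]` (the elements of `ℰ_{N,p}` are functions on
`[1,p]`). [cite: ConnesConsani2017ScalingSite, Lemma 5.19 (i)] -/
theorem IsENp.congr {p N : ℕ} {F G : ℝ → ℝ} (hp : 1 < p) (hG : IsENp p N G)
    (h : ∀ t ∈ Icc (1 : ℝ) p, G t = F t) : IsENp p N F := by
  obtain ⟨s, hs, hrepG⟩ := hG.exists_rep
  have hpR : (1 : ℝ) < p := by exact_mod_cast hp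
  have hrepF : ∀ t ∈ Icc (1 : ℝ) p, F t = ev s hs t := fun t ht => by rw [← h t ht, hrepG t ht]
  refine ⟨⟨s, hs, hrepF⟩, ?_, ?_⟩
  · rw [← h 1 ⟨le_rfl, hpR.le⟩, ← h p ⟨hpR.le, le_rfl⟩, hG.closed]
  · have := hG.order_le
    rw [derivWithin_one hp hrepG, derivWithin_p hp hrepG] at this
    rw [derivWithin_one hp hrepF, derivWithin_p hp hrepF]
    exact this

/-- **Lemma 5.19 (i)**: `ℰ_{N,p}` as rendered by `IsENp p N` is exactly the set of restrictions to
`[1,p]` of the elements of the tree's `H⁰(D)¹`, `D = (H_p, N)` ("The module `ℰ_{N,p}` is the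
`ℝ_max`-module of convex (continuous), piecewise affine functions on `[1,p]` with integral slopes,
such that `f(1) = f(p)` and `-f'₊(1) + p f'₋(p) ≤ N`"). [cite: ConnesConsani2017ScalingSite, Lemma 5.19 (i)] -/
theorem ConnesConsani2017_lemma_5_19_i {p N : ℕ} [Fact p.Prime] (hp : 1 < p) {F : ℝ → ℝ} :
    IsENp p N F ↔ ∃ G : CpH0Level (divHpN p hp N) 1, ∀ t ∈ Icc (1 : ℝ) p, G.1 t = F t := by
  constructor
  · exact exists_cpH0Level_of_isENp hp
  · rintro ⟨G, hG⟩
    exact (isENp_of_cpH0Level hp G).congr hp hG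

/-- **`γ` is the largest section of `σ`** (Connes–Consani 2017, Appendix A, last paragraph after
Lemma 6.3: among all `x` with `σ(x) = f` the coordinates `γ_a(f)` are maximal): if
`σ(x) = f` on `[1,p]` then `x_a ≤ γ_a(f)` for every `a ∈ {0, …, N-p}`.
RE-LANDED STATEMENT (pub-rhdoor LEAD pen, lad-1 gen 10, 2026-08-20): this theorem was appended
by census-t1-r3 gen 7 as revision p206355 (commit 2f821190baeb); the file was regressed to its
first revision when the stale proposal p205853 was applied on 2026-08-20T09:46Z; the signature
below is reconstructed from the cell's AXIOMS.md / MANIFEST.md descriptions of p206355 and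
re-proved here (the byte-identical original lives in commit 2f821190baeb).
[cite: ConnesConsani2017ScalingSite, App. A (last paragraph: γ is the largest section of σ)] -/
theorem ConnesConsani2017_gamma_max_section {p N : ℕ} (hp : 1 < p) (hN : p ≤ N) {f : ℝ → ℝ}
    {x : ℕ → ℝ} (hx : ∀ t ∈ Icc (1 : ℝ) p, sigma p N hN x t = f t) {a : ℕ} (ha : a + p ≤ N) :
    x a ≤ gam p N f a := by
  have hp' : (1 : ℝ) ≤ p := by exact_mod_cast hp.le
  refine le_csInf ((nonempty_Icc.2 hp').image _) ?_
  rintro _ ⟨z, hz, rfl⟩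
  have h : phi p N a z + x a ≤ sigma p N hN x z :=
    Finset.le_sup' (fun b => phi p N b z + x b) ((mem_idx hN).2 ha)
  rw [hx z hz] at h
  linarith

end ENp

end Literature.NumberTheory.ConnesConsani
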